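import Summits.QuantumFields.YangMills.Theorems.UnitScaleTiltProp7GaugeProjectorSupPackagePin
import Summits.QuantumFields.YangMills.Theorems.UnitScaleTiltProp7PcolMember
import HarnessLib

/-!
# Route `UnitScaleTilt`, crux K1 «MinimiserStabilityRegPr» (stmt-QuantumFields-19200), EX face row `norm_G`, N6 FILE C letters — **THE (c)-PACKAGE AT THE MEMBER OF RECORD:
# ★p1 g27's FILE C letters (c1) `‖toL2S⁻¹(G′ᴾ(R_S(toL2S v)))‖ ≤ C₁·m`, (c2) `‖toL2⁻¹(D(G′ᴾ(R_S(toL2S v))))‖ ≤ C₂·m`, (c3) `‖toL2S⁻¹(R_S(G′ᴾ(toL2S v)))‖ ≤ C₃·m` WITH EVERY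
# (L3′b) LETTER DISCHARGED AND MEMBER-FREE CONSTANTS `C₁⋆(am,ε₀)`, `C₂⋆`, `C₃⋆`** — the (c)-package twin of PIN-B ✓`Prop7PcolMember.hPcol_member`∕`hPcol_member_of_lift` (width seat
# `ym3-torus-px5` gen 13; chair WORD №28∕10:17:14Z «GO»; generator `work/gen/mk_cpkg_member.py` over PIN-B's text).

Cell `ym3-torus` (HUMAN RULING D-0037; rung R3 = SU(2) YM₃ on T³ — NOT d = 4, NOT infinite volume, NOT a mass gap, NOT Clay).  THEOREMS ONLY (0 `def`, 0 `sorry`);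
`--supports stmt-QuantumFields-19200 --as helper`; count-neutral.

WHAT.  ✓`Prop7GaugeProjectorSupPackagePin` §3 gives the three route letters at the pin `c₁ := c₀(L³)^{K−n}` CONDITIONAL on `hcol` (`κ`, `C_pt`), `hGsup` (`B_v`), `hT1` (`R₁`).  §1 here
discharges them exactly as PIN-B does for hPcol: `hcol ⟸` V5b ✓`hcol_of_massiveColumn_decay`, `hGsup`∕`hT1 ⟸` px12 ✓`hGsup_of_regPr`∕✓`hT1_of_regPr` (the latter under `hroom`∕`hsmall`),
all at the column window `μ(am) = 1∕(10√(max 2 (16∕am))√(27 + (2025∕8)am))` (✓`window_delta`∕`window_win`), then the unit leaves ✓`unitU3_pin`∕`unitU1_pin`∕`unitA_pin`∕✓`unitP1_pin`∕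
`unitP3_pin`∕`unitP2_pin` close the constants member-free: `C₁⋆ = √2·B_v⋆(1 + B_v⋆·C_src⋆)`, `C₂⋆ = √2·R₁⋆(1 + B_v⋆·C_src⋆)`, `C₃⋆ = √2·B_v⋆(1 + C_src⋆·B_v⋆)` with PIN-B's closed
`B_v⋆(am)`, `R₁⋆(am)`, `C_src⋆(am)` (module docstring of ✓`Prop7PcolMember`).  §2 discharges the families of record (`Q″ hseq hker`, `hRS` under the Lift antecedent, `ι`, `T`, `G`) as
✓`hPcol_member_of_lift`.
WHAT IS PROVED (ns `Summit.QuantumFields.YangMills.Theorems.Prop7GaugeProjectorSupPackageMember`): §1 ★★`norm_symm_GprimeP_RS_toL2S_le_member` (c1), ★★`norm_symm_DL2_GprimeP_RS_toL2S_le_member` (c2),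
★★`norm_symm_RS_GprimeP_toL2S_le_member` (c3); §2 ★★★`norm_symm_GprimeP_RS_toL2S_le_member_of_lift`, ★★★`norm_symm_DL2_GprimeP_RS_toL2S_le_member_of_lift`,
★★★`norm_symm_RS_GprimeP_toL2S_le_member_of_lift` — FILE C's `hc1`∕`hc2`∕`hc3` binders VERBATIM in shape (`∀ v m, (∀ x, ‖v x‖ ≤ m) → ∀ x∕b, …`) at one member of record, under
`RegPr F n K ε₀ U₀`, `10¹²L³ε₀ ≤ 1`, the Lift antecedent, `0 ≤ a′` (and `hroom`, `hsmall` for (c2)).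
HEARTBEATS (README rule): decl-local `maxHeartbeats 400000` on the six theorems (the ~4-kchar closed constants; PIN-B's `hPcol_member` precedent, measured); disclosed here and on the bus.
HYP-SAT (★★OWNER RULING №42): `RegPr`-class + Lift antecedent (EX face shape) + `0 ≤ a′` + the room∕smallness numerals of T1 (inhabited at the member of record: `hroom` for `L ≥ 2`,
`K − n ≥ 1`; `hsmall` = the α-window of ✓p765411); conclusions are sup bounds of the row's own objects; no `Prop` placeholder.
HONEST SCOPE.  Bookkeeping over landed rows; nothing of N6's knit, `norm_G`, the EX rows, EX or the crux is proved here; the Yang–Mills mass gap is NOT proved.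

References: T. Bałaban, CMP **99** (1985) 389–434 [Balaban1985BackgroundPropagators] ((3.20)–(3.25) p.394, Thm 3.1 (3.42)∕(3.46) pp.397–398, (3.49) p.399, (3.114)–(3.122) pp.418–420);
CMP **102** (1985) 277–309 [Balaban1985Variational] ((138)–(139) p.299).
-/

set_option autoImplicit false

noncomputable section

open scoped BigOperators Matrix.Norms.L2Operator InnerProductSpace ComplexConjugate Matrix

namespace Summit.QuantumFields.YangMills.Theorems.Prop7GaugeProjectorSupPackageMember

open Literature.MathematicalPhysics.QuantumFieldTheory.Balaban1983to89
open Literature.MathematicalPhysics.QuantumFieldTheory.Balaban1983to89.T3ContinuumYM3Torus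
open T4Continuum BlockAveraging
open BlockAveraging (Idx)
open B7Prop1Explicit (disp)
open B5Eq118OneStroke (iterBlockOf)
open B15DeterminingSets (embIter)
open B10Eq27TorusAxialLog (holT transl)
open B7TransferAnalyticMean (meanCLM)
open B4Sect5Torus (TSite)
open B9SectCLatticeCarrier (Bond)
open B9Eq311L2Pairing (WL2)
open B11Eq103H1Complex (SiteL2K BondL2K projR)
open Summit.QuantumFields.YangMills.Theorems.Prop8Chart (emlIterU)
open T3SectALandauChart (eta eta_pos bgUnits)
open T3PrintedRegularMinimiser (RegPr)
open T3PrintedRegularOrbits (sites_eq)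
open T3LevelShift (siteShift)
open Summit.QuantumFields.YangMills.Theorems.Prop7SectET3Transport (periodsT3 siteEquiv bondEquiv)
open Summit.QuantumFields.YangMills.Theorems.Prop7SectET3HilbertLetters (W₂ toL2 toL2S DL2 DstarL2 covLapSite)
open Summit.QuantumFields.YangMills.Theorems.Prop7SectET3GaugeProjector (NS RS)
open Summit.QuantumFields.YangMills.Theorems.Prop7SectET3DeltaPiPInv (kerDProj GprimeP)
open Summit.QuantumFields.YangMills.Theorems.Prop7LODSlotK2WindowLetters (window_delta window_win)
open Summit.QuantumFields.YangMills.Theorems.Prop7ComplementaryProjectorPointwiseDecayClosed (hcol_of_massiveColumn_decay)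
open Summit.QuantumFields.YangMills.Theorems.Prop7MassiveSolutionGradientSupOfRegPr (hGsup_of_regPr hT1_of_regPr)
open Summit.QuantumFields.YangMills.Theorems.Prop7CurvedMemberGradientRowPin (unitA_pin unitU1_pin unitU3_pin)
open Summit.QuantumFields.YangMills.Theorems.Prop7CurvedMemberLocalGradient (exists_curved_localGradient)
open Summit.QuantumFields.YangMills.Theorems.AxialGaugeChartGlue (norm_bgOfCfg_axialT_sub_le)
open Summit.QuantumFields.YangMills.Theorems.Prop7NSIntertwinerOfRecord (exists_intertwiner_of_regPr)
open Summit.QuantumFields.YangMills.Theorems.Prop7RSEqPrintProjectorOfLift (RS_eq_projR_of_lift)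
open Summit.QuantumFields.YangMills.Theorems.Prop7MassivePropagatorCoercive (exists_massive_inverse)
open Summit.QuantumFields.YangMills.Theorems.Prop7PcolMember (unitP1_pin unitP3_pin unitP2_pin)
open Summit.QuantumFields.YangMills.Theorems.Prop7GaugeProjectorSupPackagePin (norm_symm_GprimeP_RS_toL2S_le_pin norm_symm_DL2_GprimeP_RS_toL2S_le_pin norm_symm_RS_GprimeP_toL2S_le_pin)

variable (F : T3Family) {n K : ℕ} (h : n ≤ K) {c₀ cB : ℝ} [Fact (0 < c₀)] [Fact (0 < cB)]
  {ε₀ : ℝ} (hε₀ : 0 < ε₀) (hε7 : 10 ^ 7 * (F.L : ℝ) ^ 3 * ε₀ ≤ 1)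
  (U₀ : GaugeField (F.P K) 0 (Matrix.specialUnitaryGroup (Fin 2) ℂ)) (hreg : RegPr F n K ε₀ U₀)
  (Q'' : SiteL2K ℂ 3 (periodsT3 F K) c₀ W₂ →ₗ[ℂ] (Site (F.P K) (K - n) → Matrix (Fin 2) (Fin 2) ℂ))
  (hseq : ∀ lam : Site (F.P K) 0 → Matrix (Fin 2) (Fin 2) ℂ, ∃ ns : (j : ℕ) → Site (F.P K) j → Matrix (Fin 2) (Fin 2) ℂ, ns 0 = lam ∧
      (∀ (j : ℕ) (y : Site (F.P K) (j + 1)), ns (j + 1) y = ns j (emb y) - meanCLM (Idx (F.P K)) (Matrix (Fin 2) (Fin 2) ℂ) fun i : Idx (F.P K) =>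
        ns j (emb y) - ((holT (emlIterU j (bgUnits F K U₀)) (emb y) (stairWord i.2.1 (off i.1)) : (Matrix (Fin 2) (Fin 2) ℂ)ˣ) : Matrix (Fin 2) (Fin 2) ℂ) *
          ns j (transl (emb y) (disp (stairWord i.2.1 (off i.1)))) * (((holT (emlIterU j (bgUnits F K U₀)) (emb y) (stairWord i.2.1 (off i.1)))⁻¹ : (Matrix (Fin 2) (Fin 2) ℂ)ˣ) : Matrix (Fin 2) (Fin 2) ℂ)) ∧
      ns (K - n) = Q'' (toL2S F K c₀ lam))
  (hRS : RS F n K h c₀ cB U₀ = projR (covLapSite F n K c₀ U₀) Q'')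
  (hker : LinearMap.ker Q'' ≤ NS F n K h c₀ cB U₀)

/-! ## §1 The three route letters at one member (LOD letters displayed; (L3′b) letters discharged) -/

include hε₀ hε7 hreg hseq hRS hker in
-- HEARTBEAT rule (README): the ~4-kchar closed constant is matched by `rw … at hfin; exact hfin` (syntactic after the unit leaves); measured to fit a decl-local 400000 like PIN-B's `hPcol_member`; disclosed.
set_option maxHeartbeats 400000 in
/-- ★★ **FILE C's (c1) `‖toL2S⁻¹(G′ᴾ_{a′}(R_S(toL2S v))) x‖ ≤ C₁⋆·m` AT ONE MEMBER, EVERY (L3′b) LETTER DISCHARGED, MEMBER-FREE CONSTANT** (PIN ✓`norm_symm_GprimeP_RS_toL2S_le_pin` at V5b's `hcol`, px12's `hGsup` from `RegPr`, unit leaves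
✓`unitU3_pin`∕`unitU1_pin`∕`unitA_pin`∕`unitP1_pin`∕`unitP3_pin`∕`unitP2_pin`); displayed: `RegPr` (`10⁷L³ε₀ ≤ 1`), the LOD data at the pin with mass `0 < am`, `hseq`, `hRS hker`, `0 ≤ a′`.
[cite: Balaban1985BackgroundPropagators, (3.20)–(3.25) p.394, Thm 3.1 (3.42)∕(3.46) pp.397–398, (3.49) p.399, (3.114)–(3.122) pp.418–420; Balaban1985Variational, (138)–(139) p.299] -/
theorem norm_symm_GprimeP_RS_toL2S_le_member (hnK : n < K) {am : ℝ} (ham : 0 < am) [hc₁ : Fact (0 < c₀ * ((F.L : ℝ) ^ 3) ^ (K - n))]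
    (ι : (Site (F.P K) (K - n) → Matrix (Fin 2) (Fin 2) ℂ) →ₗ[ℂ] SiteL2K ℂ 3 (periodsT3 F n) (c₀ * ((F.L : ℝ) ^ 3) ^ (K - n)) W₂)
    (hι : ∀ c, ι c = toL2S F n (c₀ * ((F.L : ℝ) ^ 3) ^ (K - n)) (fun z => c (siteShift (sites_eq F n K h) z)))
    (T : SiteL2K ℂ 3 (periodsT3 F n) (c₀ * ((F.L : ℝ) ^ 3) ^ (K - n)) W₂ →ₗ[ℂ] SiteL2K ℂ 3 (periodsT3 F K) c₀ W₂)
    (hT : ∀ (l : SiteL2K ℂ 3 (periodsT3 F K) c₀ W₂) (f : SiteL2K ℂ 3 (periodsT3 F n) (c₀ * ((F.L : ℝ) ^ 3) ^ (K - n)) W₂), ⟪ι (Q'' l), f⟫_ℂ = ⟪l, T f⟫_ℂ)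
    (G : SiteL2K ℂ 3 (periodsT3 F K) c₀ W₂ →ₗ[ℂ] SiteL2K ℂ 3 (periodsT3 F K) c₀ W₂)
    (hAG : ∀ f, covLapSite F n K c₀ U₀ (G f) + (am : ℂ) • T (ι (Q'' (G f))) = f)
    (hGA : ∀ u, G (covLapSite F n K c₀ U₀ u + (am : ℂ) • T (ι (Q'' u))) = u)
    {a' : ℝ} (ha' : 0 ≤ a')
    (v : Site (F.P K) 0 → Matrix (Fin 2) (Fin 2) ℂ) {m : ℝ} (hv : ∀ x, ‖v x‖ ≤ m) (x : Site (F.P K) 0) :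
    ‖(toL2S F K c₀).symm (GprimeP F n K h c₀ cB a' U₀ (RS F n K h c₀ cB U₀ (toL2S F K c₀ v))) x‖
      ≤ Real.sqrt 2 * ((((14 * (8 * Real.exp (3 * min (1 / (10 * Real.sqrt (max 2 (16 / am)) * Real.sqrt (27 + 2025 / 8 * am))) (1 / 4)) * (1 + Real.exp (3 * (1 / (10 * Real.sqrt (max 2 (16 / am)) * Real.sqrt (27 + 2025 / 8 * am)))) * ((am * ((5 / 4) * Real.sqrt 2) * Real.sqrt (25 / 8) * (8 * Real.sqrt (max 2 (16 / am)) ^ 2)))))) + ((Real.sqrt 216 * (Real.sqrt (8 * Real.exp (3 * min (1 / (10 * Real.sqrt (max 2 (16 / am)) * Real.sqrt (27 + 2025 / 8 * am))) (1 / 4)) * Real.exp (6 * (1 / (10 * Real.sqrt (max 2 (16 / am)) * Real.sqrt (27 + 2025 / 8 * am)))) * (2 * (1 + 1 / (1 / (10 * Real.sqrt (max 2 (16 / am)) * Real.sqrt (27 + 2025 / 8 * am))))) ^ 3) * (8 * Real.sqrt (max 2 (16 / am)) ^ 2))))) * (2 * (1 + 1 / (min (1 / (10 * Real.sqrt (max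 2 (16 / am)) * Real.sqrt (27 + 2025 / 8 * am))) (1 / 4) / 2))) ^ 3) * (1 + (((14 * (8 * Real.exp (3 * min (1 / (10 * Real.sqrt (max 2 (16 / am)) * Real.sqrt (27 + 2025 / 8 * am))) (1 / 4)) * (1 + Real.exp (3 * (1 / (10 * Real.sqrt (max 2 (16 / am)) * Real.sqrt (27 + 2025 / 8 * am)))) * ((am * ((5 / 4) * Real.sqrt 2) * Real.sqrt (25 / 8) * (8 * Real.sqrt (max 2 (16 / am)) ^ 2)))))) + ((Real.sqrt 216 * (Real.sqrt (8 * Real.exp (3 * min (1 / (10 * Real.sqrt (max 2 (16 / am)) * Real.sqrt (27 + 2025 / 8 * am))) (1 / 4)) * Real.exp (6 * (1 / (10 * Real.sqrt (max 2 (16 / am)) * Real.sqrt (27 + 2025 / 8 * am)))) * (2 * (1 + 1 / (1 / (10 * Real.sqrt (max 2 (16 / am)) * Real.sqrt (27 + 2025 / 8 * am))))) ^ 3) * (8 * Real.sqrt (max 2 (16 / am)) ^ 2))))) * (2 * (1 + 1 / (min (1 / (10 * Real.sqrt (max 2 (16 / am)) * Real.sqrt (27 + 2025 / 8 * am))) (1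 / 4) / 2))) ^ 3) * (10 * (18 / (2 / ((1 + 25 / 8) * (600 * (27 / 4 : ℝ) ^ 6 + am))) ^ 2) * (4 * (2 * (1 + 1 / (min ((1 / (10 * Real.sqrt (max 2 (16 / am)) * Real.sqrt (27 + 2025 / 8 * am))) / 2) ((2 / ((1 + 25 / 8) * (600 * (27 / 4 : ℝ) ^ 6 + am))) / (3 * (Real.sqrt (max 2 (16 / am)) * (2 + Real.sqrt (max 2 (16 / am))) * (3 * Real.sqrt 3 + 27 + 9 * Real.sqrt am * Real.sqrt (25 / 8) + 81 * am * (25 / 8)) * (8 * Real.sqrt (max 2 (16 / am)) + 8 * Real.sqrt (max 2 (16 / am)) ^ 2) * (10 * Real.sqrt (25 / 8)) + 9 * (max 2 (16 / am)) * Real.sqrt (25 / 8))))))) ^ 3) * (((14 * (8 * Real.exp (3 * min (1 / (10 * Real.sqrt (max 2 (16 / am)) * Real.sqrt (27 + 2025 / 8 * am))) (1 / 4)) * (((5 / 2 : ℝ)) + Real.exp (3 * (1 / (10 * Real.sqrt (max 2 (16 / am)) * Real.sqrt (27 + 2025 / 8 * am)))) * ((am * (5 / 2) * (25 / 8) * (8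 * max 2 (16 / am))))))) + ((Real.sqrt 432 * (Real.sqrt (8 * Real.exp (3 * min (1 / (10 * Real.sqrt (max 2 (16 / am)) * Real.sqrt (27 + 2025 / 8 * am))) (1 / 4)) * Real.exp (6 * (1 / (10 * Real.sqrt (max 2 (16 / am)) * Real.sqrt (27 + 2025 / 8 * am)))) * (2 * (1 + 1 / (1 / (10 * Real.sqrt (max 2 (16 / am)) * Real.sqrt (27 + 2025 / 8 * am))))) ^ 3) * ((8 * max 2 (16 / am)) * Real.sqrt (25 / 8)))))) * (2 * (1 + 1 / (min (1 / (10 * Real.sqrt (max 2 (16 / am)) * Real.sqrt (27 + 2025 / 8 * am))) (1 / 4) / 2))) ^ 3)))) * m := by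
  have hc₀ : 0 < c₀ := Fact.out
  have hc₁ : 0 < c₀ * ((F.L : ℝ) ^ 3) ^ (K - n) := hc₁.out
  have hL1 : (1 : ℝ) < F.L := by exact_mod_cast F.hL.2
  have hL0 : (0 : ℝ) < F.L := by linarith
  have hLP := (F.P K).L_pos
  -- the pin's raw letters
  have hsx : (25 / 8) * (c₀ * ((F.L : ℝ) ^ 3) ^ (K - n) * ((((F.P K).L : ℝ) ^ (F.P K).d) ^ (K - n))⁻¹ / c₀) = 25 / 8 := by
    rw [show ((F.P K).L : ℝ) = (F.L : ℝ) from rfl, T3Family.P_d]; field_simp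
  have hMraw : 16 * c₀ * ((F.L : ℝ) ^ (K - n)) ^ 3 / (am * (c₀ * ((F.L : ℝ) ^ 3) ^ (K - n))) = 16 / am := by
    rw [← pow_mul, ← pow_mul, Nat.mul_comm]; field_simp
  have hM : max 2 (16 * c₀ * ((F.L : ℝ) ^ (K - n)) ^ 3 / (am * (c₀ * ((F.L : ℝ) ^ 3) ^ (K - n)))) = max 2 (16 / am) := by rw [hMraw]
  have hη : 0 < eta F n K := eta_pos F n K
  have hη1 : eta F n K ≤ 1 := by
    show ((F.L : ℝ)⁻¹) ^ (K - n) ≤ 1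
    exact pow_le_one₀ (inv_nonneg.2 hL0.le) (inv_le_one_of_one_le₀ hL1.le)
  -- the column window at slope `μ(am)` (W1: `window_delta` for `3μ ≤ 1`, `window_win` with EQUALITY at `μ(am)`)
  have hM'2 : (2 : ℝ) ≤ max 2 (16 / am) := le_max_left _ _
  have hcδ1 : (1 : ℝ) ≤ 27 + 2025 / 8 * am := by linarith [ham.le]
  have hsM1 : 1 ≤ Real.sqrt (max 2 (16 / am)) := Real.one_le_sqrt.2 (by linarith)
  have hsc1 : 1 ≤ Real.sqrt (27 + 2025 / 8 * am) := Real.one_le_sqrt.2 hcδ1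
  have hμ0 : 0 < (1 / (10 * Real.sqrt (max 2 (16 / am)) * Real.sqrt (27 + 2025 / 8 * am))) := by positivity
  have hμ10 : 10 * (1 / (10 * Real.sqrt (max 2 (16 / am)) * Real.sqrt (27 + 2025 / 8 * am))) ≤ 1 := by
    have h1 : (1 : ℝ) ≤ Real.sqrt (max 2 (16 / am)) * Real.sqrt (27 + 2025 / 8 * am) := one_le_mul_of_one_le_of_one_le hsM1 hsc1
    rw [show 10 * (1 / (10 * Real.sqrt (max 2 (16 / am)) * Real.sqrt (27 + 2025 / 8 * am))) = 1 / (Real.sqrt (max 2 (16 / am)) * Real.sqrt (27 + 2025 / 8 * am)) by field_simp]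
    rw [div_le_one (by positivity)]
    exact h1
  have hμ3 : 3 * (1 / (10 * Real.sqrt (max 2 (16 / am)) * Real.sqrt (27 + 2025 / 8 * am))) ≤ 1 := by linarith
  have hδ := window_delta (a := am) (sx := ((25 / 8) * (c₀ * ((F.L : ℝ) ^ 3) ^ (K - n) * ((((F.P K).L : ℝ) ^ (F.P K).d) ^ (K - n))⁻¹ / c₀))) (η := eta F n K) ham hsx hη hη1 hμ0.le hμ3
  have hwin := window_win ham hM
  -- the three letters at the pin
  have hcol := hcol_of_massiveColumn_decay F h hε₀ hε7 U₀ hreg Q'' hseq ι hι T hT ham G hAG hμ0 (δ₂ := Real.sqrt (27 + 2025 / 8 * am) * (1 / (10 * Real.sqrt (max 2 (16 / am)) * Real.sqrt (27 + 2025 / 8 * am)))) (by positivity) hδ hwin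
  have hGsup := hGsup_of_regPr F h hε₀ hε7 U₀ hreg Q'' hseq ι hι T hT ham G hAG hμ0 (δ₁ := Real.sqrt (27 + 2025 / 8 * am) * (1 / (10 * Real.sqrt (max 2 (16 / am)) * Real.sqrt (27 + 2025 / 8 * am)))) (by positivity) hδ hwin
  have hκ : 0 < min (1 / (10 * Real.sqrt (max 2 (16 / am)) * Real.sqrt (27 + 2025 / 8 * am))) (1 / 4) / 2 := by positivity
  have hCpt : 0 ≤ (14 * (8 * Real.exp (3 * min (1 / (10 * Real.sqrt (max 2 (16 / am)) * Real.sqrt (27 + 2025 / 8 * am))) (1 / 4)) * ((5 / 4) * Real.sqrt (2 * (c₀ * ((F.L : ℝ) ^ 3) ^ (K - n))) * ((((F.P K).L : ℝ) ^ (F.P K).d) ^ (K - n))⁻¹ / c₀ * Real.sqrt (2 * (c₀ * ((F.L : ℝ) ^ 3) ^ (K - n))) + Real.exp (3 * (1 / (10 * Real.sqrt (max 2 (16 / am)) * Real.sqrt (27 + 2025 / 8 * am)))) * ((am * ((5 / 4) * Real.sqrt (2 * (c₀ * ((F.L : ℝ) ^ 3) ^ (K - n))) * ((((F.P K).L : ℝ)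 ^ (F.P K).d) ^ (K - n))⁻¹ / c₀) * Real.sqrt ((25 / 8) * ((c₀ * ((F.L : ℝ) ^ 3) ^ (K - n)) * ((((F.P K).L : ℝ) ^ (F.P K).d) ^ (K - n))⁻¹ / c₀))) * ((8 * Real.sqrt (max 2 (16 * c₀ * ((F.L : ℝ) ^ (K - n)) ^ 3 / (am * (c₀ * ((F.L : ℝ) ^ 3) ^ (K - n))))) ^ 2) * (Real.sqrt ((25 / 8) * ((c₀ * ((F.L : ℝ) ^ 3) ^ (K - n)) * ((((F.P K).L : ℝ) ^ (F.P K).d) ^ (K - n))⁻¹ / c₀)) * Real.sqrt (2 * (c₀ * ((F.L : ℝ) ^ 3) ^ (K - n))))))))) + (Real.sqrt (3 ^ 3 / (c₀ * ((F.L : ℝ) ^ (K - n)) ^ 3) * 8) * (Real.sqrt (8 * Real.exp (3 * min (1 / (10 * Real.sqrt (max 2 (16 / am)) * Real.sqrt (27 + 2025 / 8 * am))) (1 / 4)) * Real.exp (6 * (1 / (10 * Real.sqrt (max 2 (16 / am)) * Real.sqrt (27 + 2025 / 8 * am)))) * (2 * (1 + 1 / (1 / (10 * Real.sqrt (max 2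 (16 / am)) * Real.sqrt (27 + 2025 / 8 * am))))) ^ 3) * ((8 * Real.sqrt (max 2 (16 * c₀ * ((F.L : ℝ) ^ (K - n)) ^ 3 / (am * (c₀ * ((F.L : ℝ) ^ 3) ^ (K - n))))) ^ 2) * (Real.sqrt ((25 / 8) * ((c₀ * ((F.L : ℝ) ^ 3) ^ (K - n)) * ((((F.P K).L : ℝ) ^ (F.P K).d) ^ (K - n))⁻¹ / c₀)) * Real.sqrt (2 * (c₀ * ((F.L : ℝ) ^ 3) ^ (K - n))))))) := by positivity
  -- the PIN at these letters
  have hfin := norm_symm_GprimeP_RS_toL2S_le_pin F h hε₀ hε7 U₀ hreg Q'' hseq hRS hker hnK ham ι hι T hT G hAG hGA ha' hκ hCpt hcol hGsup v hv x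
  -- the leaves
  rw [unitU3_pin F hc₀ ham, unitU1_pin F hc₀ ham, unitA_pin F hc₀, unitP1_pin F hc₀ ham, unitP2_pin F hc₀ ham] at hfin
  exact hfin

include hε₀ hε7 hreg hseq hRS hker in
-- HEARTBEAT rule (README): the ~4-kchar closed constant is matched by `rw … at hfin; exact hfin` (syntactic after the unit leaves); measured to fit a decl-local 400000 like PIN-B's `hPcol_member`; disclosed.
set_option maxHeartbeats 400000 in
/-- ★★ **FILE C's (c2) `‖toL2⁻¹(D_{U₀}(G′ᴾ_{a′}(R_S(toL2S v)))) b‖ ≤ C₂⋆·m` AT ONE MEMBER, EVERY (L3′b) LETTER DISCHARGED, MEMBER-FREE CONSTANT** (PIN ✓`norm_symm_DL2_GprimeP_RS_toL2S_le_pin` at V5b's `hcol`, px12's `hGsup`∕`hT1` from `RegPr`, unit leaves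
✓`unitU3_pin`∕`unitU1_pin`∕`unitA_pin`∕`unitP1_pin`∕`unitP3_pin`∕`unitP2_pin`); displayed: `RegPr` (`10⁷L³ε₀ ≤ 1`), the LOD data at the pin with mass `0 < am`, `hseq`, `hRS hker`, `0 ≤ a′`, `hroom`, `hsmall`.
[cite: Balaban1985BackgroundPropagators, (3.20)–(3.25) p.394, Thm 3.1 (3.42)∕(3.46) pp.397–398, (3.49) p.399, (3.114)–(3.122) pp.418–420; Balaban1985Variational, (138)–(139) p.299] -/
theorem norm_symm_DL2_GprimeP_RS_toL2S_le_member (hnK : n < K) {am : ℝ} (ham : 0 < am) [hc₁ : Fact (0 < c₀ * ((F.L : ℝ) ^ 3) ^ (K - n))]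
    (ι : (Site (F.P K) (K - n) → Matrix (Fin 2) (Fin 2) ℂ) →ₗ[ℂ] SiteL2K ℂ 3 (periodsT3 F n) (c₀ * ((F.L : ℝ) ^ 3) ^ (K - n)) W₂)
    (hι : ∀ c, ι c = toL2S F n (c₀ * ((F.L : ℝ) ^ 3) ^ (K - n)) (fun z => c (siteShift (sites_eq F n K h) z)))
    (T : SiteL2K ℂ 3 (periodsT3 F n) (c₀ * ((F.L : ℝ) ^ 3) ^ (K - n)) W₂ →ₗ[ℂ] SiteL2K ℂ 3 (periodsT3 F K) c₀ W₂)
    (hT : ∀ (l : SiteL2K ℂ 3 (periodsT3 F K) c₀ W₂) (f : SiteL2K ℂ 3 (periodsT3 F n) (c₀ * ((F.L : ℝ) ^ 3) ^ (K - n)) W₂), ⟪ι (Q'' l), f⟫_ℂ = ⟪l, T f⟫_ℂ)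
    (G : SiteL2K ℂ 3 (periodsT3 F K) c₀ W₂ →ₗ[ℂ] SiteL2K ℂ 3 (periodsT3 F K) c₀ W₂)
    (hAG : ∀ f, covLapSite F n K c₀ U₀ (G f) + (am : ℂ) • T (ι (Q'' (G f))) = f)
    (hGA : ∀ u, G (covLapSite F n K c₀ U₀ u + (am : ℂ) • T (ι (Q'' u))) = u)
    {a' : ℝ} (ha' : 0 ≤ a')
    (hroom : 2 * (12 * F.L ^ (K - n) + 5) ≤ (F.P K).sitesPerDir 0)
    (hsmall : exists_curved_localGradient.choose * ((48 * ε₀) * (6 * Real.sqrt 2 * Real.sqrt 10 + 6 * Real.sqrt 2)) ≤ 1 / 2)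
    (v : Site (F.P K) 0 → Matrix (Fin 2) (Fin 2) ℂ) {m : ℝ} (hv : ∀ x, ‖v x‖ ≤ m) (b : PBond (F.P K) 0) :
    ‖(toL2 F K c₀).symm (DL2 F n K c₀ U₀ (GprimeP F n K h c₀ cB a' U₀ (RS F n K h c₀ cB U₀ (toL2S F K c₀ v)))) b‖
      ≤ Real.sqrt 2 * ((2 * (exists_curved_localGradient.choose * ((((14 * (8 * Real.exp (3 * min (1 / (10 * Real.sqrt (max 2 (16 / am)) * Real.sqrt (27 + 2025 / 8 * am))) (1 / 4)) * (1 + Real.exp (3 * (1 / (10 * Real.sqrt (max 2 (16 / am)) * Real.sqrt (27 + 2025 / 8 * am)))) * ((am * ((5 / 4) * Real.sqrt 2) * Real.sqrt (25 / 8) * (8 * Real.sqrt (max 2 (16 / am)) ^ 2)))))) + ((Real.sqrt 216 * (Real.sqrt (8 * Real.exp (3 * min (1 / (10 * Real.sqrt (max 2 (16 / am)) * Real.sqrt (27 + 2025 / 8 * am))) (1 / 4)) * Real.exp (6 * (1 / (10 * Real.sqrt (max 2 (16 / am)) * Real.sqrt (27 + 2025 / 8 * am)))) * (2 * (1 + 1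 / (1 / (10 * Real.sqrt (max 2 (16 / am)) * Real.sqrt (27 + 2025 / 8 * am))))) ^ 3) * (8 * Real.sqrt (max 2 (16 / am)) ^ 2))))) * (2 * (1 + 1 / (min (1 / (10 * Real.sqrt (max 2 (16 / am)) * Real.sqrt (27 + 2025 / 8 * am))) (1 / 4) / 2))) ^ 3) * (2 + 2 * Real.sqrt 2 * (4 * ε₀ * (3 + 2457 * norm_bgOfCfg_axialT_sub_le.choose)) + (24 * Real.sqrt 10 + 48) * (48 * ε₀) ^ 2) + (((am * ((5 / 4) * Real.sqrt 2) * Real.sqrt (25 / 8) * (Real.exp (3 * (1 / (10 * Real.sqrt (max 2 (16 / am)) * Real.sqrt (27 + 2025 / 8 * am)))) * (8 * Real.sqrt (max 2 (16 / am)) ^ 2))) * (2 * (1 + 1 / (1 / (10 * Real.sqrt (max 2 (16 / am)) * Real.sqrt (27 + 2025 / 8 * am))))) ^ 3) + 1)) + 2 * Real.sqrt 2 * (48 * ε₀) * (((14 * (8 * Real.exp (3 * min (1 / (10 * Real.sqrt (max 2 (16 / am)) * Real.sqrt (27 + 2025 / 8 * am))) (1 / 4)) * (1 + Real.exp (3 *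 (1 / (10 * Real.sqrt (max 2 (16 / am)) * Real.sqrt (27 + 2025 / 8 * am)))) * ((am * ((5 / 4) * Real.sqrt 2) * Real.sqrt (25 / 8) * (8 * Real.sqrt (max 2 (16 / am)) ^ 2)))))) + ((Real.sqrt 216 * (Real.sqrt (8 * Real.exp (3 * min (1 / (10 * Real.sqrt (max 2 (16 / am)) * Real.sqrt (27 + 2025 / 8 * am))) (1 / 4)) * Real.exp (6 * (1 / (10 * Real.sqrt (max 2 (16 / am)) * Real.sqrt (27 + 2025 / 8 * am)))) * (2 * (1 + 1 / (1 / (10 * Real.sqrt (max 2 (16 / am)) * Real.sqrt (27 + 2025 / 8 * am))))) ^ 3) * (8 * Real.sqrt (max 2 (16 / am)) ^ 2))))) * (2 * (1 + 1 / (min (1 / (10 * Real.sqrt (max 2 (16 / am)) * Real.sqrt (27 + 2025 / 8 * am))) (1 / 4) / 2))) ^ 3))) * (1 + (((14 * (8 * Real.exp (3 * min (1 / (10 * Real.sqrt (max 2 (16 / am)) * Real.sqrt (27 + 2025 / 8 * am))) (1 / 4)) * (1 + Real.exp (3 * (1 / (10 * Real.sqrt (max 2 (16 / am)) * Real.sqrt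 (27 + 2025 / 8 * am)))) * ((am * ((5 / 4) * Real.sqrt 2) * Real.sqrt (25 / 8) * (8 * Real.sqrt (max 2 (16 / am)) ^ 2)))))) + ((Real.sqrt 216 * (Real.sqrt (8 * Real.exp (3 * min (1 / (10 * Real.sqrt (max 2 (16 / am)) * Real.sqrt (27 + 2025 / 8 * am))) (1 / 4)) * Real.exp (6 * (1 / (10 * Real.sqrt (max 2 (16 / am)) * Real.sqrt (27 + 2025 / 8 * am)))) * (2 * (1 + 1 / (1 / (10 * Real.sqrt (max 2 (16 / am)) * Real.sqrt (27 + 2025 / 8 * am))))) ^ 3) * (8 * Real.sqrt (max 2 (16 / am)) ^ 2))))) * (2 * (1 + 1 / (min (1 / (10 * Real.sqrt (max 2 (16 / am)) * Real.sqrt (27 + 2025 / 8 * am))) (1 / 4) / 2))) ^ 3) * (10 * (18 / (2 / ((1 + 25 / 8) * (600 * (27 / 4 : ℝ) ^ 6 + am))) ^ 2) * (4 * (2 * (1 + 1 / (min ((1 / (10 * Real.sqrt (max 2 (16 / am)) * Real.sqrt (27 + 2025 / 8 * am))) / 2) ((2 / ((1 + 25 / 8) * (600 * (27 / 4 : ℝ)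 ^ 6 + am))) / (3 * (Real.sqrt (max 2 (16 / am)) * (2 + Real.sqrt (max 2 (16 / am))) * (3 * Real.sqrt 3 + 27 + 9 * Real.sqrt am * Real.sqrt (25 / 8) + 81 * am * (25 / 8)) * (8 * Real.sqrt (max 2 (16 / am)) + 8 * Real.sqrt (max 2 (16 / am)) ^ 2) * (10 * Real.sqrt (25 / 8)) + 9 * (max 2 (16 / am)) * Real.sqrt (25 / 8))))))) ^ 3) * (((14 * (8 * Real.exp (3 * min (1 / (10 * Real.sqrt (max 2 (16 / am)) * Real.sqrt (27 + 2025 / 8 * am))) (1 / 4)) * (((5 / 2 : ℝ)) + Real.exp (3 * (1 / (10 * Real.sqrt (max 2 (16 / am)) * Real.sqrt (27 + 2025 / 8 * am)))) * ((am * (5 / 2) * (25 / 8) * (8 * max 2 (16 / am))))))) + ((Real.sqrt 432 * (Real.sqrt (8 * Real.exp (3 * min (1 / (10 * Real.sqrt (max 2 (16 / am)) * Real.sqrt (27 + 2025 / 8 * am))) (1 / 4)) * Real.exp (6 * (1 / (10 * Real.sqrt (max 2 (16 / am)) * Real.sqrt (27 + 2025 / 8 * am)))) * (2 * (1 + 1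 / (1 / (10 * Real.sqrt (max 2 (16 / am)) * Real.sqrt (27 + 2025 / 8 * am))))) ^ 3) * ((8 * max 2 (16 / am)) * Real.sqrt (25 / 8)))))) * (2 * (1 + 1 / (min (1 / (10 * Real.sqrt (max 2 (16 / am)) * Real.sqrt (27 + 2025 / 8 * am))) (1 / 4) / 2))) ^ 3)))) * m := by
  have hc₀ : 0 < c₀ := Fact.out
  have hc₁ : 0 < c₀ * ((F.L : ℝ) ^ 3) ^ (K - n) := hc₁.out
  have hL1 : (1 : ℝ) < F.L := by exact_mod_cast F.hL.2
  have hL0 : (0 : ℝ) < F.L := by linarith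
  have hLP := (F.P K).L_pos
  -- the pin's raw letters
  have hsx : (25 / 8) * (c₀ * ((F.L : ℝ) ^ 3) ^ (K - n) * ((((F.P K).L : ℝ) ^ (F.P K).d) ^ (K - n))⁻¹ / c₀) = 25 / 8 := by
    rw [show ((F.P K).L : ℝ) = (F.L : ℝ) from rfl, T3Family.P_d]; field_simp
  have hMraw : 16 * c₀ * ((F.L : ℝ) ^ (K - n)) ^ 3 / (am * (c₀ * ((F.L : ℝ) ^ 3) ^ (K - n))) = 16 / am := by
    rw [← pow_mul, ← pow_mul, Nat.mul_comm]; field_simp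
  have hM : max 2 (16 * c₀ * ((F.L : ℝ) ^ (K - n)) ^ 3 / (am * (c₀ * ((F.L : ℝ) ^ 3) ^ (K - n)))) = max 2 (16 / am) := by rw [hMraw]
  have hη : 0 < eta F n K := eta_pos F n K
  have hη1 : eta F n K ≤ 1 := by
    show ((F.L : ℝ)⁻¹) ^ (K - n) ≤ 1
    exact pow_le_one₀ (inv_nonneg.2 hL0.le) (inv_le_one_of_one_le₀ hL1.le)
  -- the column window at slope `μ(am)` (W1: `window_delta` for `3μ ≤ 1`, `window_win` with EQUALITY at `μ(am)`)
  have hM'2 : (2 : ℝ) ≤ max 2 (16 / am) := le_max_left _ _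
  have hcδ1 : (1 : ℝ) ≤ 27 + 2025 / 8 * am := by linarith [ham.le]
  have hsM1 : 1 ≤ Real.sqrt (max 2 (16 / am)) := Real.one_le_sqrt.2 (by linarith)
  have hsc1 : 1 ≤ Real.sqrt (27 + 2025 / 8 * am) := Real.one_le_sqrt.2 hcδ1
  have hμ0 : 0 < (1 / (10 * Real.sqrt (max 2 (16 / am)) * Real.sqrt (27 + 2025 / 8 * am))) := by positivity
  have hμ10 : 10 * (1 / (10 * Real.sqrt (max 2 (16 / am)) * Real.sqrt (27 + 2025 / 8 * am))) ≤ 1 := by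
    have h1 : (1 : ℝ) ≤ Real.sqrt (max 2 (16 / am)) * Real.sqrt (27 + 2025 / 8 * am) := one_le_mul_of_one_le_of_one_le hsM1 hsc1
    rw [show 10 * (1 / (10 * Real.sqrt (max 2 (16 / am)) * Real.sqrt (27 + 2025 / 8 * am))) = 1 / (Real.sqrt (max 2 (16 / am)) * Real.sqrt (27 + 2025 / 8 * am)) by field_simp]
    rw [div_le_one (by positivity)]
    exact h1
  have hμ3 : 3 * (1 / (10 * Real.sqrt (max 2 (16 / am)) * Real.sqrt (27 + 2025 / 8 * am))) ≤ 1 := by linarith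
  have hδ := window_delta (a := am) (sx := ((25 / 8) * (c₀ * ((F.L : ℝ) ^ 3) ^ (K - n) * ((((F.P K).L : ℝ) ^ (F.P K).d) ^ (K - n))⁻¹ / c₀))) (η := eta F n K) ham hsx hη hη1 hμ0.le hμ3
  have hwin := window_win ham hM
  -- the three letters at the pin
  have hcol := hcol_of_massiveColumn_decay F h hε₀ hε7 U₀ hreg Q'' hseq ι hι T hT ham G hAG hμ0 (δ₂ := Real.sqrt (27 + 2025 / 8 * am) * (1 / (10 * Real.sqrt (max 2 (16 / am)) * Real.sqrt (27 + 2025 / 8 * am)))) (by positivity) hδ hwin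
  have hGsup := hGsup_of_regPr F h hε₀ hε7 U₀ hreg Q'' hseq ι hι T hT ham G hAG hμ0 (δ₁ := Real.sqrt (27 + 2025 / 8 * am) * (1 / (10 * Real.sqrt (max 2 (16 / am)) * Real.sqrt (27 + 2025 / 8 * am)))) (by positivity) hδ hwin
  have hT1 := hT1_of_regPr F h hε₀ hε7 U₀ hreg Q'' hseq ι hι T hT ham G hAG hμ0 (δ₁ := Real.sqrt (27 + 2025 / 8 * am) * (1 / (10 * Real.sqrt (max 2 (16 / am)) * Real.sqrt (27 + 2025 / 8 * am)))) (by positivity) hδ hwin hroom hsmall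
  have hκ : 0 < min (1 / (10 * Real.sqrt (max 2 (16 / am)) * Real.sqrt (27 + 2025 / 8 * am))) (1 / 4) / 2 := by positivity
  have hCpt : 0 ≤ (14 * (8 * Real.exp (3 * min (1 / (10 * Real.sqrt (max 2 (16 / am)) * Real.sqrt (27 + 2025 / 8 * am))) (1 / 4)) * ((5 / 4) * Real.sqrt (2 * (c₀ * ((F.L : ℝ) ^ 3) ^ (K - n))) * ((((F.P K).L : ℝ) ^ (F.P K).d) ^ (K - n))⁻¹ / c₀ * Real.sqrt (2 * (c₀ * ((F.L : ℝ) ^ 3) ^ (K - n))) + Real.exp (3 * (1 / (10 * Real.sqrt (max 2 (16 / am)) * Real.sqrt (27 + 2025 / 8 * am)))) * ((am * ((5 / 4) * Real.sqrt (2 * (c₀ * ((F.L : ℝ) ^ 3) ^ (K - n))) * ((((F.P K).L : ℝ) ^ (F.P K).d) ^ (K - n))⁻¹ / c₀) * Real.sqrt ((25 / 8) * ((c₀ * ((F.L : ℝ) ^ 3) ^ (K - n)) * ((((F.P K).L : ℝ) ^ (F.P K).d) ^ (K - n))⁻¹ / c₀))) * ((8 * Real.sqrt (max 2 (16 * c₀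 * ((F.L : ℝ) ^ (K - n)) ^ 3 / (am * (c₀ * ((F.L : ℝ) ^ 3) ^ (K - n))))) ^ 2) * (Real.sqrt ((25 / 8) * ((c₀ * ((F.L : ℝ) ^ 3) ^ (K - n)) * ((((F.P K).L : ℝ) ^ (F.P K).d) ^ (K - n))⁻¹ / c₀)) * Real.sqrt (2 * (c₀ * ((F.L : ℝ) ^ 3) ^ (K - n))))))))) + (Real.sqrt (3 ^ 3 / (c₀ * ((F.L : ℝ) ^ (K - n)) ^ 3) * 8) * (Real.sqrt (8 * Real.exp (3 * min (1 / (10 * Real.sqrt (max 2 (16 / am)) * Real.sqrt (27 + 2025 / 8 * am))) (1 / 4)) * Real.exp (6 * (1 / (10 * Real.sqrt (max 2 (16 / am)) * Real.sqrt (27 + 2025 / 8 * am)))) * (2 * (1 + 1 / (1 / (10 * Real.sqrt (max 2 (16 / am)) * Real.sqrt (27 + 2025 / 8 * am))))) ^ 3) * ((8 * Real.sqrt (max 2 (16 * c₀ * ((F.L : ℝ) ^ (K - n)) ^ 3 / (am * (c₀ * ((F.L : ℝ) ^ 3) ^ (K - n))))) ^ 2) * (Real.sqrt ((25 / 8) *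 ((c₀ * ((F.L : ℝ) ^ 3) ^ (K - n)) * ((((F.P K).L : ℝ) ^ (F.P K).d) ^ (K - n))⁻¹ / c₀)) * Real.sqrt (2 * (c₀ * ((F.L : ℝ) ^ 3) ^ (K - n))))))) := by positivity
  -- the PIN at these letters
  have hfin := norm_symm_DL2_GprimeP_RS_toL2S_le_pin F h hε₀ hε7 U₀ hreg Q'' hseq hRS hker hnK ham ι hι T hT G hAG hGA ha' hκ hCpt hcol hGsup hT1 v hv b
  -- the leaves
  rw [unitU3_pin F hc₀ ham, unitU1_pin F hc₀ ham, unitA_pin F hc₀, unitP1_pin F hc₀ ham, unitP3_pin F hc₀ ham, unitP2_pin F hc₀ ham] at hfin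
  exact hfin

include hε₀ hε7 hreg hseq hRS hker in
-- HEARTBEAT rule (README): the ~4-kchar closed constant is matched by `rw … at hfin; exact hfin` (syntactic after the unit leaves); measured to fit a decl-local 400000 like PIN-B's `hPcol_member`; disclosed.
set_option maxHeartbeats 400000 in
/-- ★★ **FILE C's (c3) `‖toL2S⁻¹(R_S(G′ᴾ_{a′}(toL2S v))) x‖ ≤ C₃⋆·m` AT ONE MEMBER, EVERY (L3′b) LETTER DISCHARGED, MEMBER-FREE CONSTANT** (PIN ✓`norm_symm_RS_GprimeP_toL2S_le_pin` at V5b's `hcol`, px12's `hGsup` from `RegPr`, unit leaves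
✓`unitU3_pin`∕`unitU1_pin`∕`unitA_pin`∕`unitP1_pin`∕`unitP3_pin`∕`unitP2_pin`); displayed: `RegPr` (`10⁷L³ε₀ ≤ 1`), the LOD data at the pin with mass `0 < am`, `hseq`, `hRS hker`, `0 ≤ a′`.
[cite: Balaban1985BackgroundPropagators, (3.20)–(3.25) p.394, Thm 3.1 (3.42)∕(3.46) pp.397–398, (3.49) p.399, (3.114)–(3.122) pp.418–420; Balaban1985Variational, (138)–(139) p.299] -/
theorem norm_symm_RS_GprimeP_toL2S_le_member (hnK : n < K) {am : ℝ} (ham : 0 < am) [hc₁ : Fact (0 < c₀ * ((F.L : ℝ) ^ 3) ^ (K - n))]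
    (ι : (Site (F.P K) (K - n) → Matrix (Fin 2) (Fin 2) ℂ) →ₗ[ℂ] SiteL2K ℂ 3 (periodsT3 F n) (c₀ * ((F.L : ℝ) ^ 3) ^ (K - n)) W₂)
    (hι : ∀ c, ι c = toL2S F n (c₀ * ((F.L : ℝ) ^ 3) ^ (K - n)) (fun z => c (siteShift (sites_eq F n K h) z)))
    (T : SiteL2K ℂ 3 (periodsT3 F n) (c₀ * ((F.L : ℝ) ^ 3) ^ (K - n)) W₂ →ₗ[ℂ] SiteL2K ℂ 3 (periodsT3 F K) c₀ W₂)
    (hT : ∀ (l : SiteL2K ℂ 3 (periodsT3 F K) c₀ W₂) (f : SiteL2K ℂ 3 (periodsT3 F n) (c₀ * ((F.L : ℝ) ^ 3) ^ (K - n)) W₂), ⟪ι (Q'' l), f⟫_ℂ = ⟪l, T f⟫_ℂ)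
    (G : SiteL2K ℂ 3 (periodsT3 F K) c₀ W₂ →ₗ[ℂ] SiteL2K ℂ 3 (periodsT3 F K) c₀ W₂)
    (hAG : ∀ f, covLapSite F n K c₀ U₀ (G f) + (am : ℂ) • T (ι (Q'' (G f))) = f)
    (hGA : ∀ u, G (covLapSite F n K c₀ U₀ u + (am : ℂ) • T (ι (Q'' u))) = u)
    {a' : ℝ} (ha' : 0 ≤ a')
    (v : Site (F.P K) 0 → Matrix (Fin 2) (Fin 2) ℂ) {m : ℝ} (hv : ∀ x, ‖v x‖ ≤ m) (x : Site (F.P K) 0) :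
    ‖(toL2S F K c₀).symm (RS F n K h c₀ cB U₀ (GprimeP F n K h c₀ cB a' U₀ (toL2S F K c₀ v))) x‖
      ≤ Real.sqrt 2 * ((((14 * (8 * Real.exp (3 * min (1 / (10 * Real.sqrt (max 2 (16 / am)) * Real.sqrt (27 + 2025 / 8 * am))) (1 / 4)) * (1 + Real.exp (3 * (1 / (10 * Real.sqrt (max 2 (16 / am)) * Real.sqrt (27 + 2025 / 8 * am)))) * ((am * ((5 / 4) * Real.sqrt 2) * Real.sqrt (25 / 8) * (8 * Real.sqrt (max 2 (16 / am)) ^ 2)))))) + ((Real.sqrt 216 * (Real.sqrt (8 * Real.exp (3 * min (1 / (10 * Real.sqrt (max 2 (16 / am)) * Real.sqrt (27 + 2025 / 8 * am))) (1 / 4)) * Real.exp (6 * (1 / (10 * Real.sqrt (max 2 (16 / am)) * Real.sqrt (27 + 2025 / 8 * am)))) * (2 * (1 + 1 / (1 / (10 * Real.sqrt (max 2 (16 / am)) * Real.sqrt (27 + 2025 / 8 * am))))) ^ 3) * (8 * Real.sqrt (max 2 (16 / am)) ^ 2))))) * (2 * (1 + 1 / (min (1 / (10 * Real.sqrt (max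 2 (16 / am)) * Real.sqrt (27 + 2025 / 8 * am))) (1 / 4) / 2))) ^ 3) * (1 + (10 * (18 / (2 / ((1 + 25 / 8) * (600 * (27 / 4 : ℝ) ^ 6 + am))) ^ 2) * (4 * (2 * (1 + 1 / (min ((1 / (10 * Real.sqrt (max 2 (16 / am)) * Real.sqrt (27 + 2025 / 8 * am))) / 2) ((2 / ((1 + 25 / 8) * (600 * (27 / 4 : ℝ) ^ 6 + am))) / (3 * (Real.sqrt (max 2 (16 / am)) * (2 + Real.sqrt (max 2 (16 / am))) * (3 * Real.sqrt 3 + 27 + 9 * Real.sqrt am * Real.sqrt (25 / 8) + 81 * am * (25 / 8)) * (8 * Real.sqrt (max 2 (16 / am)) + 8 * Real.sqrt (max 2 (16 / am)) ^ 2) * (10 * Real.sqrt (25 / 8)) + 9 * (max 2 (16 / am)) * Real.sqrt (25 / 8))))))) ^ 3) * (((14 * (8 * Real.exp (3 * min (1 / (10 * Real.sqrt (max 2 (16 / am)) * Real.sqrt (27 + 2025 / 8 * am))) (1 / 4)) * (((5 / 2 : ℝ)) + Real.exp (3 * (1 / (10 * Real.sqrt (max 2 (16 / am)) * Real.sqrt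 (27 + 2025 / 8 * am)))) * ((am * (5 / 2) * (25 / 8) * (8 * max 2 (16 / am))))))) + ((Real.sqrt 432 * (Real.sqrt (8 * Real.exp (3 * min (1 / (10 * Real.sqrt (max 2 (16 / am)) * Real.sqrt (27 + 2025 / 8 * am))) (1 / 4)) * Real.exp (6 * (1 / (10 * Real.sqrt (max 2 (16 / am)) * Real.sqrt (27 + 2025 / 8 * am)))) * (2 * (1 + 1 / (1 / (10 * Real.sqrt (max 2 (16 / am)) * Real.sqrt (27 + 2025 / 8 * am))))) ^ 3) * ((8 * max 2 (16 / am)) * Real.sqrt (25 / 8)))))) * (2 * (1 + 1 / (min (1 / (10 * Real.sqrt (max 2 (16 / am)) * Real.sqrt (27 + 2025 / 8 * am))) (1 / 4) / 2))) ^ 3)) * (((14 * (8 * Real.exp (3 * min (1 / (10 * Real.sqrt (max 2 (16 / am)) * Real.sqrt (27 + 2025 / 8 * am))) (1 / 4)) * (1 + Real.exp (3 * (1 / (10 * Real.sqrt (max 2 (16 / am)) * Real.sqrt (27 + 2025 / 8 * am)))) * ((am * ((5 / 4) * Real.sqrt 2) * Real.sqrt (25 / 8) * (8 * Real.sqrt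 (max 2 (16 / am)) ^ 2)))))) + ((Real.sqrt 216 * (Real.sqrt (8 * Real.exp (3 * min (1 / (10 * Real.sqrt (max 2 (16 / am)) * Real.sqrt (27 + 2025 / 8 * am))) (1 / 4)) * Real.exp (6 * (1 / (10 * Real.sqrt (max 2 (16 / am)) * Real.sqrt (27 + 2025 / 8 * am)))) * (2 * (1 + 1 / (1 / (10 * Real.sqrt (max 2 (16 / am)) * Real.sqrt (27 + 2025 / 8 * am))))) ^ 3) * (8 * Real.sqrt (max 2 (16 / am)) ^ 2))))) * (2 * (1 + 1 / (min (1 / (10 * Real.sqrt (max 2 (16 / am)) * Real.sqrt (27 + 2025 / 8 * am))) (1 / 4) / 2))) ^ 3))) * m := by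
  have hc₀ : 0 < c₀ := Fact.out
  have hc₁ : 0 < c₀ * ((F.L : ℝ) ^ 3) ^ (K - n) := hc₁.out
  have hL1 : (1 : ℝ) < F.L := by exact_mod_cast F.hL.2
  have hL0 : (0 : ℝ) < F.L := by linarith
  have hLP := (F.P K).L_pos
  -- the pin's raw letters
  have hsx : (25 / 8) * (c₀ * ((F.L : ℝ) ^ 3) ^ (K - n) * ((((F.P K).L : ℝ) ^ (F.P K).d) ^ (K - n))⁻¹ / c₀) = 25 / 8 := by
    rw [show ((F.P K).L : ℝ) = (F.L : ℝ) from rfl, T3Family.P_d]; field_simp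
  have hMraw : 16 * c₀ * ((F.L : ℝ) ^ (K - n)) ^ 3 / (am * (c₀ * ((F.L : ℝ) ^ 3) ^ (K - n))) = 16 / am := by
    rw [← pow_mul, ← pow_mul, Nat.mul_comm]; field_simp
  have hM : max 2 (16 * c₀ * ((F.L : ℝ) ^ (K - n)) ^ 3 / (am * (c₀ * ((F.L : ℝ) ^ 3) ^ (K - n)))) = max 2 (16 / am) := by rw [hMraw]
  have hη : 0 < eta F n K := eta_pos F n K
  have hη1 : eta F n K ≤ 1 := by
    show ((F.L : ℝ)⁻¹) ^ (K - n) ≤ 1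
    exact pow_le_one₀ (inv_nonneg.2 hL0.le) (inv_le_one_of_one_le₀ hL1.le)
  -- the column window at slope `μ(am)` (W1: `window_delta` for `3μ ≤ 1`, `window_win` with EQUALITY at `μ(am)`)
  have hM'2 : (2 : ℝ) ≤ max 2 (16 / am) := le_max_left _ _
  have hcδ1 : (1 : ℝ) ≤ 27 + 2025 / 8 * am := by linarith [ham.le]
  have hsM1 : 1 ≤ Real.sqrt (max 2 (16 / am)) := Real.one_le_sqrt.2 (by linarith)
  have hsc1 : 1 ≤ Real.sqrt (27 + 2025 / 8 * am) := Real.one_le_sqrt.2 hcδ1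
  have hμ0 : 0 < (1 / (10 * Real.sqrt (max 2 (16 / am)) * Real.sqrt (27 + 2025 / 8 * am))) := by positivity
  have hμ10 : 10 * (1 / (10 * Real.sqrt (max 2 (16 / am)) * Real.sqrt (27 + 2025 / 8 * am))) ≤ 1 := by
    have h1 : (1 : ℝ) ≤ Real.sqrt (max 2 (16 / am)) * Real.sqrt (27 + 2025 / 8 * am) := one_le_mul_of_one_le_of_one_le hsM1 hsc1
    rw [show 10 * (1 / (10 * Real.sqrt (max 2 (16 / am)) * Real.sqrt (27 + 2025 / 8 * am))) = 1 / (Real.sqrt (max 2 (16 / am)) * Real.sqrt (27 + 2025 / 8 * am)) by field_simp]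
    rw [div_le_one (by positivity)]
    exact h1
  have hμ3 : 3 * (1 / (10 * Real.sqrt (max 2 (16 / am)) * Real.sqrt (27 + 2025 / 8 * am))) ≤ 1 := by linarith
  have hδ := window_delta (a := am) (sx := ((25 / 8) * (c₀ * ((F.L : ℝ) ^ 3) ^ (K - n) * ((((F.P K).L : ℝ) ^ (F.P K).d) ^ (K - n))⁻¹ / c₀))) (η := eta F n K) ham hsx hη hη1 hμ0.le hμ3
  have hwin := window_win ham hM
  -- the three letters at the pin
  have hcol := hcol_of_massiveColumn_decay F h hε₀ hε7 U₀ hreg Q'' hseq ι hι T hT ham G hAG hμ0 (δ₂ := Real.sqrt (27 + 2025 / 8 * am) * (1 / (10 * Real.sqrt (max 2 (16 / am)) * Real.sqrt (27 + 2025 / 8 * am)))) (by positivity) hδ hwin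
  have hGsup := hGsup_of_regPr F h hε₀ hε7 U₀ hreg Q'' hseq ι hι T hT ham G hAG hμ0 (δ₁ := Real.sqrt (27 + 2025 / 8 * am) * (1 / (10 * Real.sqrt (max 2 (16 / am)) * Real.sqrt (27 + 2025 / 8 * am)))) (by positivity) hδ hwin
  have hκ : 0 < min (1 / (10 * Real.sqrt (max 2 (16 / am)) * Real.sqrt (27 + 2025 / 8 * am))) (1 / 4) / 2 := by positivity
  have hCpt : 0 ≤ (14 * (8 * Real.exp (3 * min (1 / (10 * Real.sqrt (max 2 (16 / am)) * Real.sqrt (27 + 2025 / 8 * am))) (1 / 4)) * ((5 / 4) * Real.sqrt (2 * (c₀ * ((F.L : ℝ) ^ 3) ^ (K - n))) * ((((F.P K).L : ℝ) ^ (F.P K).d) ^ (K - n))⁻¹ / c₀ * Real.sqrt (2 * (c₀ * ((F.L : ℝ) ^ 3) ^ (K - n))) + Real.exp (3 * (1 / (10 * Real.sqrt (max 2 (16 / am)) * Real.sqrt (27 + 2025 / 8 * am)))) * ((am * ((5 / 4) * Real.sqrt (2 * (c₀ * ((F.L : ℝ) ^ 3) ^ (K - n))) * ((((F.P K).L : ℝ)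 ^ (F.P K).d) ^ (K - n))⁻¹ / c₀) * Real.sqrt ((25 / 8) * ((c₀ * ((F.L : ℝ) ^ 3) ^ (K - n)) * ((((F.P K).L : ℝ) ^ (F.P K).d) ^ (K - n))⁻¹ / c₀))) * ((8 * Real.sqrt (max 2 (16 * c₀ * ((F.L : ℝ) ^ (K - n)) ^ 3 / (am * (c₀ * ((F.L : ℝ) ^ 3) ^ (K - n))))) ^ 2) * (Real.sqrt ((25 / 8) * ((c₀ * ((F.L : ℝ) ^ 3) ^ (K - n)) * ((((F.P K).L : ℝ) ^ (F.P K).d) ^ (K - n))⁻¹ / c₀)) * Real.sqrt (2 * (c₀ * ((F.L : ℝ) ^ 3) ^ (K - n))))))))) + (Real.sqrt (3 ^ 3 / (c₀ * ((F.L : ℝ) ^ (K - n)) ^ 3) * 8) * (Real.sqrt (8 * Real.exp (3 * min (1 / (10 * Real.sqrt (max 2 (16 / am)) * Real.sqrt (27 + 2025 / 8 * am))) (1 / 4)) * Real.exp (6 * (1 / (10 * Real.sqrt (max 2 (16 / am)) * Real.sqrt (27 + 2025 / 8 * am)))) * (2 * (1 + 1 / (1 / (10 * Real.sqrt (max 2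 (16 / am)) * Real.sqrt (27 + 2025 / 8 * am))))) ^ 3) * ((8 * Real.sqrt (max 2 (16 * c₀ * ((F.L : ℝ) ^ (K - n)) ^ 3 / (am * (c₀ * ((F.L : ℝ) ^ 3) ^ (K - n))))) ^ 2) * (Real.sqrt ((25 / 8) * ((c₀ * ((F.L : ℝ) ^ 3) ^ (K - n)) * ((((F.P K).L : ℝ) ^ (F.P K).d) ^ (K - n))⁻¹ / c₀)) * Real.sqrt (2 * (c₀ * ((F.L : ℝ) ^ 3) ^ (K - n))))))) := by positivity
  -- the PIN at these letters
  have hfin := norm_symm_RS_GprimeP_toL2S_le_pin F h hε₀ hε7 U₀ hreg Q'' hseq hRS hker hnK ham ι hι T hT G hAG hGA ha' hκ hCpt hcol hGsup v hv x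
  -- the leaves
  rw [unitU3_pin F hc₀ ham, unitU1_pin F hc₀ ham, unitA_pin F hc₀, unitP1_pin F hc₀ ham, unitP2_pin F hc₀ ham] at hfin
  exact hfin

/-! ## §2 The same with the families of record discharged (Lift antecedent displayed) -/

section Member
include hε₀ hreg in
set_option maxHeartbeats 400000 in
/-- ★★★ **FILE C's (c1) AT ONE MEMBER, FAMILIES OF RECORD DISCHARGED** — with `Q″ hseq hker ← exists_intertwiner_of_regPr`, `hRS ← RS_eq_projR_of_lift (hLift)`, `ι` by `rfl`,
`T := (ι∘Q″)†`, `G ← exists_massive_inverse` (mass `am`); displayed: `RegPr F n K ε₀ U₀` with `10¹²L³ε₀ ≤ 1`, the face's Lift antecedent, `0 ≤ a′`; constant = the member's.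
[cite: Balaban1985BackgroundPropagators, (3.20)–(3.25) p.394, Thm 3.1 (3.42)∕(3.46) pp.397–398, (3.49) p.399, (3.114)–(3.122) pp.418–420; Balaban1985Variational, (138)–(139) p.299] -/
theorem norm_symm_GprimeP_RS_toL2S_le_member_of_lift (hnK : n < K) (hε12 : 10 ^ 12 * (F.L : ℝ) ^ 3 * ε₀ ≤ 1) {am : ℝ} (ham : 0 < am)
    (hLift : ∀ cf : Site (F.P K) (K - n) → Matrix (Fin 2) (Fin 2) ℂ,
      (∀ e : PBond (F.P K) (K - n), cf e.src = ((emlIterU (K - n) (bgUnits F K U₀) e : (Matrix (Fin 2) (Fin 2) ℂ)ˣ) : Matrix (Fin 2) (Fin 2) ℂ) * cf e.tgt *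
        (((emlIterU (K - n) (bgUnits F K U₀) e)⁻¹ : (Matrix (Fin 2) (Fin 2) ℂ)ˣ) : Matrix (Fin 2) (Fin 2) ℂ)) →
      ∃ l₀ : Site (F.P K) 0 → Matrix (Fin 2) (Fin 2) ℂ,
        (∀ b : PBond (F.P K) 0, l₀ b.src = ((bgUnits F K U₀ b : (Matrix (Fin 2) (Fin 2) ℂ)ˣ) : Matrix (Fin 2) (Fin 2) ℂ) * l₀ b.tgt * (((bgUnits F K U₀ b)⁻¹ : (Matrix (Fin 2) (Fin 2) ℂ)ˣ) : Matrix (Fin 2) (Fin 2) ℂ)) ∧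
        ∀ y : Site (F.P K) (K - n), l₀ (embIter (K - n) y) = cf y)
    {a' : ℝ} (ha' : 0 ≤ a')
    (v : Site (F.P K) 0 → Matrix (Fin 2) (Fin 2) ℂ) {m : ℝ} (hv : ∀ x, ‖v x‖ ≤ m) (x : Site (F.P K) 0) :
    ‖(toL2S F K c₀).symm (GprimeP F n K h c₀ cB a' U₀ (RS F n K h c₀ cB U₀ (toL2S F K c₀ v))) x‖
      ≤ Real.sqrt 2 * ((((14 * (8 * Real.exp (3 * min (1 / (10 * Real.sqrt (max 2 (16 / am)) * Real.sqrt (27 + 2025 / 8 * am))) (1 / 4)) * (1 + Real.exp (3 * (1 / (10 * Real.sqrt (max 2 (16 / am)) * Real.sqrt (27 + 2025 / 8 * am)))) * ((am * ((5 / 4) * Real.sqrt 2) * Real.sqrt (25 / 8) * (8 * Real.sqrt (max 2 (16 / am)) ^ 2)))))) + ((Real.sqrt 216 * (Real.sqrt (8 * Real.exp (3 * min (1 / (10 * Real.sqrt (max 2 (16 / am)) * Real.sqrt (27 + 2025 / 8 * am))) (1 / 4)) * Real.exp (6 * (1 / (10 * Real.sqrt (max 2 (16 / am)) * Real.sqrt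 (27 + 2025 / 8 * am)))) * (2 * (1 + 1 / (1 / (10 * Real.sqrt (max 2 (16 / am)) * Real.sqrt (27 + 2025 / 8 * am))))) ^ 3) * (8 * Real.sqrt (max 2 (16 / am)) ^ 2))))) * (2 * (1 + 1 / (min (1 / (10 * Real.sqrt (max 2 (16 / am)) * Real.sqrt (27 + 2025 / 8 * am))) (1 / 4) / 2))) ^ 3) * (1 + (((14 * (8 * Real.exp (3 * min (1 / (10 * Real.sqrt (max 2 (16 / am)) * Real.sqrt (27 + 2025 / 8 * am))) (1 / 4)) * (1 + Real.exp (3 * (1 / (10 * Real.sqrt (max 2 (16 / am)) * Real.sqrt (27 + 2025 / 8 * am)))) * ((am * ((5 / 4) * Real.sqrt 2) * Real.sqrt (25 / 8) * (8 * Real.sqrt (max 2 (16 / am)) ^ 2)))))) + ((Real.sqrt 216 * (Real.sqrt (8 * Real.exp (3 * min (1 / (10 * Real.sqrt (max 2 (16 / am)) * Real.sqrt (27 + 2025 / 8 * am))) (1 / 4)) * Real.exp (6 * (1 / (10 * Real.sqrt (max 2 (16 / am)) * Real.sqrt (27 + 2025 / 8 * am)))) * (2 * (1 + 1 / (1 /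 (10 * Real.sqrt (max 2 (16 / am)) * Real.sqrt (27 + 2025 / 8 * am))))) ^ 3) * (8 * Real.sqrt (max 2 (16 / am)) ^ 2))))) * (2 * (1 + 1 / (min (1 / (10 * Real.sqrt (max 2 (16 / am)) * Real.sqrt (27 + 2025 / 8 * am))) (1 / 4) / 2))) ^ 3) * (10 * (18 / (2 / ((1 + 25 / 8) * (600 * (27 / 4 : ℝ) ^ 6 + am))) ^ 2) * (4 * (2 * (1 + 1 / (min ((1 / (10 * Real.sqrt (max 2 (16 / am)) * Real.sqrt (27 + 2025 / 8 * am))) / 2) ((2 / ((1 + 25 / 8) * (600 * (27 / 4 : ℝ) ^ 6 + am))) / (3 * (Real.sqrt (max 2 (16 / am)) * (2 + Real.sqrt (max 2 (16 / am))) * (3 * Real.sqrt 3 + 27 + 9 * Real.sqrt am * Real.sqrt (25 / 8) + 81 * am * (25 / 8)) * (8 * Real.sqrt (max 2 (16 / am)) + 8 * Real.sqrt (max 2 (16 / am)) ^ 2) * (10 * Real.sqrt (25 / 8)) + 9 * (max 2 (16 / am)) * Real.sqrt (25 / 8))))))) ^ 3) * (((14 * (8 * Real.exp (3 * min (1 /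 (10 * Real.sqrt (max 2 (16 / am)) * Real.sqrt (27 + 2025 / 8 * am))) (1 / 4)) * (((5 / 2 : ℝ)) + Real.exp (3 * (1 / (10 * Real.sqrt (max 2 (16 / am)) * Real.sqrt (27 + 2025 / 8 * am)))) * ((am * (5 / 2) * (25 / 8) * (8 * max 2 (16 / am))))))) + ((Real.sqrt 432 * (Real.sqrt (8 * Real.exp (3 * min (1 / (10 * Real.sqrt (max 2 (16 / am)) * Real.sqrt (27 + 2025 / 8 * am))) (1 / 4)) * Real.exp (6 * (1 / (10 * Real.sqrt (max 2 (16 / am)) * Real.sqrt (27 + 2025 / 8 * am)))) * (2 * (1 + 1 / (1 / (10 * Real.sqrt (max 2 (16 / am)) * Real.sqrt (27 + 2025 / 8 * am))))) ^ 3) * ((8 * max 2 (16 / am)) * Real.sqrt (25 / 8)))))) * (2 * (1 + 1 / (min (1 / (10 * Real.sqrt (max 2 (16 / am)) * Real.sqrt (27 + 2025 / 8 * am))) (1 / 4) / 2))) ^ 3)))) * m := by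
  have hc₀ : 0 < c₀ := Fact.out
  have hL : (0 : ℝ) < F.L := by have := F.hL.2; exact_mod_cast (by omega : 0 < F.L)
  have hε7 : 10 ^ 7 * (F.L : ℝ) ^ 3 * ε₀ ≤ 1 := by
    have h1 : (10 : ℝ) ^ 7 * (F.L : ℝ) ^ 3 * ε₀ ≤ 10 ^ 12 * (F.L : ℝ) ^ 3 * ε₀ := by
      have : 0 ≤ (F.L : ℝ) ^ 3 * ε₀ := by positivity
      nlinarith
    exact h1.trans hε12
  -- the `Q″` of record, its ∃-form top-mean clause and `ker Q″ ≤ N_S`; the Lift identity `R_S = projR Δ Q″`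
  obtain ⟨Q'', D', -, -, htop, hseq, hker⟩ := exists_intertwiner_of_regPr F h (c₀ := c₀) cB hε₀ hε12 U₀ hreg
  have hRS := RS_eq_projR_of_lift F h cB hε₀ hε12 U₀ hreg hLift Q'' htop hker
  -- the LOD data at the pinned weight: `ι` by `rfl`, `T := (ι∘Q″)†`, `G ← exists_massive_inverse`
  haveI : Fact (0 < c₀ * ((F.L : ℝ) ^ 3) ^ (K - n)) := ⟨by positivity⟩
  obtain ⟨ι', hι'⟩ : ∃ ι' : (Site (F.P K) (K - n) → Matrix (Fin 2) (Fin 2) ℂ) →ₗ[ℂ] SiteL2K ℂ 3 (periodsT3 F n) (c₀ * ((F.L : ℝ) ^ 3) ^ (K - n)) W₂,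
      ∀ c, ι' c = toL2S F n (c₀ * ((F.L : ℝ) ^ 3) ^ (K - n)) (fun z => c (siteShift (sites_eq F n K h) z)) :=
    ⟨(toL2S F n (c₀ * ((F.L : ℝ) ^ 3) ^ (K - n))).toLinearMap ∘ₗ LinearMap.funLeft ℂ (Matrix (Fin 2) (Fin 2) ℂ) (siteShift (sites_eq F n K h)), fun c => rfl⟩
  obtain ⟨T', hT'⟩ : ∃ T' : SiteL2K ℂ 3 (periodsT3 F n) (c₀ * ((F.L : ℝ) ^ 3) ^ (K - n)) W₂ →ₗ[ℂ] SiteL2K ℂ 3 (periodsT3 F K) c₀ W₂,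
      ∀ (l : SiteL2K ℂ 3 (periodsT3 F K) c₀ W₂) (f : SiteL2K ℂ 3 (periodsT3 F n) (c₀ * ((F.L : ℝ) ^ 3) ^ (K - n)) W₂), ⟪ι' (Q'' l), f⟫_ℂ = ⟪l, T' f⟫_ℂ :=
    ⟨LinearMap.adjoint (ι' ∘ₗ Q''), fun l f => by rw [LinearMap.adjoint_inner_right, LinearMap.comp_apply]⟩
  obtain ⟨G', hAG', hGA', -⟩ := exists_massive_inverse F h hε₀ hε7 U₀ hreg Q'' hseq ι' hι' T' hT' ham
  exact norm_symm_GprimeP_RS_toL2S_le_member F h hε₀ hε7 U₀ hreg Q'' hseq hRS hker hnK ham ι' hι' T' hT' G' hAG' hGA' ha' v hv x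

include hε₀ hreg in
set_option maxHeartbeats 400000 in
/-- ★★★ **FILE C's (c2) AT ONE ROOMY MEMBER, FAMILIES OF RECORD DISCHARGED** — with `Q″ hseq hker ← exists_intertwiner_of_regPr`, `hRS ← RS_eq_projR_of_lift (hLift)`, `ι` by `rfl`,
`T := (ι∘Q″)†`, `G ← exists_massive_inverse` (mass `am`); displayed: `RegPr F n K ε₀ U₀` with `10¹²L³ε₀ ≤ 1`, the face's Lift antecedent, `0 ≤ a′`, `hroom`, `hsmall`; constant = the member's.
[cite: Balaban1985BackgroundPropagators, (3.20)–(3.25) p.394, Thm 3.1 (3.42)∕(3.46) pp.397–398, (3.49) p.399, (3.114)–(3.122) pp.418–420; Balaban1985Variational, (138)–(139) p.299] -/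
theorem norm_symm_DL2_GprimeP_RS_toL2S_le_member_of_lift (hnK : n < K) (hε12 : 10 ^ 12 * (F.L : ℝ) ^ 3 * ε₀ ≤ 1) {am : ℝ} (ham : 0 < am)
    (hLift : ∀ cf : Site (F.P K) (K - n) → Matrix (Fin 2) (Fin 2) ℂ,
      (∀ e : PBond (F.P K) (K - n), cf e.src = ((emlIterU (K - n) (bgUnits F K U₀) e : (Matrix (Fin 2) (Fin 2) ℂ)ˣ) : Matrix (Fin 2) (Fin 2) ℂ) * cf e.tgt *
        (((emlIterU (K - n) (bgUnits F K U₀) e)⁻¹ : (Matrix (Fin 2) (Fin 2) ℂ)ˣ) : Matrix (Fin 2) (Fin 2) ℂ)) →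
      ∃ l₀ : Site (F.P K) 0 → Matrix (Fin 2) (Fin 2) ℂ,
        (∀ b : PBond (F.P K) 0, l₀ b.src = ((bgUnits F K U₀ b : (Matrix (Fin 2) (Fin 2) ℂ)ˣ) : Matrix (Fin 2) (Fin 2) ℂ) * l₀ b.tgt * (((bgUnits F K U₀ b)⁻¹ : (Matrix (Fin 2) (Fin 2) ℂ)ˣ) : Matrix (Fin 2) (Fin 2) ℂ)) ∧
        ∀ y : Site (F.P K) (K - n), l₀ (embIter (K - n) y) = cf y)
    {a' : ℝ} (ha' : 0 ≤ a')
    (hroom : 2 * (12 * F.L ^ (K - n) + 5) ≤ (F.P K).sitesPerDir 0)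
    (hsmall : exists_curved_localGradient.choose * ((48 * ε₀) * (6 * Real.sqrt 2 * Real.sqrt 10 + 6 * Real.sqrt 2)) ≤ 1 / 2)
    (v : Site (F.P K) 0 → Matrix (Fin 2) (Fin 2) ℂ) {m : ℝ} (hv : ∀ x, ‖v x‖ ≤ m) (b : PBond (F.P K) 0) :
    ‖(toL2 F K c₀).symm (DL2 F n K c₀ U₀ (GprimeP F n K h c₀ cB a' U₀ (RS F n K h c₀ cB U₀ (toL2S F K c₀ v)))) b‖
      ≤ Real.sqrt 2 * ((2 * (exists_curved_localGradient.choose * ((((14 * (8 * Real.exp (3 * min (1 / (10 * Real.sqrt (max 2 (16 / am)) * Real.sqrt (27 + 2025 / 8 * am))) (1 / 4)) * (1 + Real.exp (3 * (1 / (10 * Real.sqrt (max 2 (16 / am)) * Real.sqrt (27 + 2025 / 8 * am)))) * ((am * ((5 / 4) * Real.sqrt 2) * Real.sqrt (25 / 8) * (8 * Real.sqrt (max 2 (16 / am)) ^ 2)))))) + ((Real.sqrt 216 * (Real.sqrt (8 * Real.exp (3 * min (1 / (10 * Real.sqrt (max 2 (16 / am)) * Real.sqrt (27 + 2025 / 8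 * am))) (1 / 4)) * Real.exp (6 * (1 / (10 * Real.sqrt (max 2 (16 / am)) * Real.sqrt (27 + 2025 / 8 * am)))) * (2 * (1 + 1 / (1 / (10 * Real.sqrt (max 2 (16 / am)) * Real.sqrt (27 + 2025 / 8 * am))))) ^ 3) * (8 * Real.sqrt (max 2 (16 / am)) ^ 2))))) * (2 * (1 + 1 / (min (1 / (10 * Real.sqrt (max 2 (16 / am)) * Real.sqrt (27 + 2025 / 8 * am))) (1 / 4) / 2))) ^ 3) * (2 + 2 * Real.sqrt 2 * (4 * ε₀ * (3 + 2457 * norm_bgOfCfg_axialT_sub_le.choose)) + (24 * Real.sqrt 10 + 48) * (48 * ε₀) ^ 2) + (((am * ((5 / 4) * Real.sqrt 2) * Real.sqrt (25 / 8) * (Real.exp (3 * (1 / (10 * Real.sqrt (max 2 (16 / am)) * Real.sqrt (27 + 2025 / 8 * am)))) * (8 * Real.sqrt (max 2 (16 / am)) ^ 2))) * (2 * (1 + 1 / (1 / (10 * Real.sqrt (max 2 (16 / am)) * Real.sqrt (27 + 2025 / 8 * am))))) ^ 3) + 1)) + 2 * Real.sqrt 2 * (48 * ε₀) * (((14 *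 (8 * Real.exp (3 * min (1 / (10 * Real.sqrt (max 2 (16 / am)) * Real.sqrt (27 + 2025 / 8 * am))) (1 / 4)) * (1 + Real.exp (3 * (1 / (10 * Real.sqrt (max 2 (16 / am)) * Real.sqrt (27 + 2025 / 8 * am)))) * ((am * ((5 / 4) * Real.sqrt 2) * Real.sqrt (25 / 8) * (8 * Real.sqrt (max 2 (16 / am)) ^ 2)))))) + ((Real.sqrt 216 * (Real.sqrt (8 * Real.exp (3 * min (1 / (10 * Real.sqrt (max 2 (16 / am)) * Real.sqrt (27 + 2025 / 8 * am))) (1 / 4)) * Real.exp (6 * (1 / (10 * Real.sqrt (max 2 (16 / am)) * Real.sqrt (27 + 2025 / 8 * am)))) * (2 * (1 + 1 / (1 / (10 * Real.sqrt (max 2 (16 / am)) * Real.sqrt (27 + 2025 / 8 * am))))) ^ 3) * (8 * Real.sqrt (max 2 (16 / am)) ^ 2))))) * (2 * (1 + 1 / (min (1 / (10 * Real.sqrt (max 2 (16 / am)) * Real.sqrt (27 + 2025 / 8 * am))) (1 / 4) / 2))) ^ 3))) * (1 + (((14 * (8 * Real.exp (3 * min (1 / (10 * Real.sqrt (max 2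 (16 / am)) * Real.sqrt (27 + 2025 / 8 * am))) (1 / 4)) * (1 + Real.exp (3 * (1 / (10 * Real.sqrt (max 2 (16 / am)) * Real.sqrt (27 + 2025 / 8 * am)))) * ((am * ((5 / 4) * Real.sqrt 2) * Real.sqrt (25 / 8) * (8 * Real.sqrt (max 2 (16 / am)) ^ 2)))))) + ((Real.sqrt 216 * (Real.sqrt (8 * Real.exp (3 * min (1 / (10 * Real.sqrt (max 2 (16 / am)) * Real.sqrt (27 + 2025 / 8 * am))) (1 / 4)) * Real.exp (6 * (1 / (10 * Real.sqrt (max 2 (16 / am)) * Real.sqrt (27 + 2025 / 8 * am)))) * (2 * (1 + 1 / (1 / (10 * Real.sqrt (max 2 (16 / am)) * Real.sqrt (27 + 2025 / 8 * am))))) ^ 3) * (8 * Real.sqrt (max 2 (16 / am)) ^ 2))))) * (2 * (1 + 1 / (min (1 / (10 * Real.sqrt (max 2 (16 / am)) * Real.sqrt (27 + 2025 / 8 * am))) (1 / 4) / 2))) ^ 3) * (10 * (18 / (2 / ((1 + 25 / 8) * (600 * (27 / 4 : ℝ) ^ 6 + am))) ^ 2) * (4 * (2 * (1 + 1 / (min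 ((1 / (10 * Real.sqrt (max 2 (16 / am)) * Real.sqrt (27 + 2025 / 8 * am))) / 2) ((2 / ((1 + 25 / 8) * (600 * (27 / 4 : ℝ) ^ 6 + am))) / (3 * (Real.sqrt (max 2 (16 / am)) * (2 + Real.sqrt (max 2 (16 / am))) * (3 * Real.sqrt 3 + 27 + 9 * Real.sqrt am * Real.sqrt (25 / 8) + 81 * am * (25 / 8)) * (8 * Real.sqrt (max 2 (16 / am)) + 8 * Real.sqrt (max 2 (16 / am)) ^ 2) * (10 * Real.sqrt (25 / 8)) + 9 * (max 2 (16 / am)) * Real.sqrt (25 / 8))))))) ^ 3) * (((14 * (8 * Real.exp (3 * min (1 / (10 * Real.sqrt (max 2 (16 / am)) * Real.sqrt (27 + 2025 / 8 * am))) (1 / 4)) * (((5 / 2 : ℝ)) + Real.exp (3 * (1 / (10 * Real.sqrt (max 2 (16 / am)) * Real.sqrt (27 + 2025 / 8 * am)))) * ((am * (5 / 2) * (25 / 8) * (8 * max 2 (16 / am))))))) + ((Real.sqrt 432 * (Real.sqrt (8 * Real.exp (3 * min (1 / (10 * Real.sqrt (max 2 (16 / am)) * Real.sqrt (27 + 2025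 / 8 * am))) (1 / 4)) * Real.exp (6 * (1 / (10 * Real.sqrt (max 2 (16 / am)) * Real.sqrt (27 + 2025 / 8 * am)))) * (2 * (1 + 1 / (1 / (10 * Real.sqrt (max 2 (16 / am)) * Real.sqrt (27 + 2025 / 8 * am))))) ^ 3) * ((8 * max 2 (16 / am)) * Real.sqrt (25 / 8)))))) * (2 * (1 + 1 / (min (1 / (10 * Real.sqrt (max 2 (16 / am)) * Real.sqrt (27 + 2025 / 8 * am))) (1 / 4) / 2))) ^ 3)))) * m := by
  have hc₀ : 0 < c₀ := Fact.out
  have hL : (0 : ℝ) < F.L := by have := F.hL.2; exact_mod_cast (by omega : 0 < F.L)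
  have hε7 : 10 ^ 7 * (F.L : ℝ) ^ 3 * ε₀ ≤ 1 := by
    have h1 : (10 : ℝ) ^ 7 * (F.L : ℝ) ^ 3 * ε₀ ≤ 10 ^ 12 * (F.L : ℝ) ^ 3 * ε₀ := by
      have : 0 ≤ (F.L : ℝ) ^ 3 * ε₀ := by positivity
      nlinarith
    exact h1.trans hε12
  -- the `Q″` of record, its ∃-form top-mean clause and `ker Q″ ≤ N_S`; the Lift identity `R_S = projR Δ Q″`
  obtain ⟨Q'', D', -, -, htop, hseq, hker⟩ := exists_intertwiner_of_regPr F h (c₀ := c₀) cB hε₀ hε12 U₀ hreg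
  have hRS := RS_eq_projR_of_lift F h cB hε₀ hε12 U₀ hreg hLift Q'' htop hker
  -- the LOD data at the pinned weight: `ι` by `rfl`, `T := (ι∘Q″)†`, `G ← exists_massive_inverse`
  haveI : Fact (0 < c₀ * ((F.L : ℝ) ^ 3) ^ (K - n)) := ⟨by positivity⟩
  obtain ⟨ι', hι'⟩ : ∃ ι' : (Site (F.P K) (K - n) → Matrix (Fin 2) (Fin 2) ℂ) →ₗ[ℂ] SiteL2K ℂ 3 (periodsT3 F n) (c₀ * ((F.L : ℝ) ^ 3) ^ (K - n)) W₂,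
      ∀ c, ι' c = toL2S F n (c₀ * ((F.L : ℝ) ^ 3) ^ (K - n)) (fun z => c (siteShift (sites_eq F n K h) z)) :=
    ⟨(toL2S F n (c₀ * ((F.L : ℝ) ^ 3) ^ (K - n))).toLinearMap ∘ₗ LinearMap.funLeft ℂ (Matrix (Fin 2) (Fin 2) ℂ) (siteShift (sites_eq F n K h)), fun c => rfl⟩
  obtain ⟨T', hT'⟩ : ∃ T' : SiteL2K ℂ 3 (periodsT3 F n) (c₀ * ((F.L : ℝ) ^ 3) ^ (K - n)) W₂ →ₗ[ℂ] SiteL2K ℂ 3 (periodsT3 F K) c₀ W₂,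
      ∀ (l : SiteL2K ℂ 3 (periodsT3 F K) c₀ W₂) (f : SiteL2K ℂ 3 (periodsT3 F n) (c₀ * ((F.L : ℝ) ^ 3) ^ (K - n)) W₂), ⟪ι' (Q'' l), f⟫_ℂ = ⟪l, T' f⟫_ℂ :=
    ⟨LinearMap.adjoint (ι' ∘ₗ Q''), fun l f => by rw [LinearMap.adjoint_inner_right, LinearMap.comp_apply]⟩
  obtain ⟨G', hAG', hGA', -⟩ := exists_massive_inverse F h hε₀ hε7 U₀ hreg Q'' hseq ι' hι' T' hT' ham
  exact norm_symm_DL2_GprimeP_RS_toL2S_le_member F h hε₀ hε7 U₀ hreg Q'' hseq hRS hker hnK ham ι' hι' T' hT' G' hAG' hGA' ha' hroom hsmall v hv b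

include hε₀ hreg in
set_option maxHeartbeats 400000 in
/-- ★★★ **FILE C's (c3) AT ONE MEMBER, FAMILIES OF RECORD DISCHARGED** — with `Q″ hseq hker ← exists_intertwiner_of_regPr`, `hRS ← RS_eq_projR_of_lift (hLift)`, `ι` by `rfl`,
`T := (ι∘Q″)†`, `G ← exists_massive_inverse` (mass `am`); displayed: `RegPr F n K ε₀ U₀` with `10¹²L³ε₀ ≤ 1`, the face's Lift antecedent, `0 ≤ a′`; constant = the member's.
[cite: Balaban1985BackgroundPropagators, (3.20)–(3.25) p.394, Thm 3.1 (3.42)∕(3.46) pp.397–398, (3.49) p.399, (3.114)–(3.122) pp.418–420; Balaban1985Variational, (138)–(139) p.299] -/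
theorem norm_symm_RS_GprimeP_toL2S_le_member_of_lift (hnK : n < K) (hε12 : 10 ^ 12 * (F.L : ℝ) ^ 3 * ε₀ ≤ 1) {am : ℝ} (ham : 0 < am)
    (hLift : ∀ cf : Site (F.P K) (K - n) → Matrix (Fin 2) (Fin 2) ℂ,
      (∀ e : PBond (F.P K) (K - n), cf e.src = ((emlIterU (K - n) (bgUnits F K U₀) e : (Matrix (Fin 2) (Fin 2) ℂ)ˣ) : Matrix (Fin 2) (Fin 2) ℂ) * cf e.tgt *
        (((emlIterU (K - n) (bgUnits F K U₀) e)⁻¹ : (Matrix (Fin 2) (Fin 2) ℂ)ˣ) : Matrix (Fin 2) (Fin 2) ℂ)) →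
      ∃ l₀ : Site (F.P K) 0 → Matrix (Fin 2) (Fin 2) ℂ,
        (∀ b : PBond (F.P K) 0, l₀ b.src = ((bgUnits F K U₀ b : (Matrix (Fin 2) (Fin 2) ℂ)ˣ) : Matrix (Fin 2) (Fin 2) ℂ) * l₀ b.tgt * (((bgUnits F K U₀ b)⁻¹ : (Matrix (Fin 2) (Fin 2) ℂ)ˣ) : Matrix (Fin 2) (Fin 2) ℂ)) ∧
        ∀ y : Site (F.P K) (K - n), l₀ (embIter (K - n) y) = cf y)
    {a' : ℝ} (ha' : 0 ≤ a')
    (v : Site (F.P K) 0 → Matrix (Fin 2) (Fin 2) ℂ) {m : ℝ} (hv : ∀ x, ‖v x‖ ≤ m) (x : Site (F.P K) 0) :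
    ‖(toL2S F K c₀).symm (RS F n K h c₀ cB U₀ (GprimeP F n K h c₀ cB a' U₀ (toL2S F K c₀ v))) x‖
      ≤ Real.sqrt 2 * ((((14 * (8 * Real.exp (3 * min (1 / (10 * Real.sqrt (max 2 (16 / am)) * Real.sqrt (27 + 2025 / 8 * am))) (1 / 4)) * (1 + Real.exp (3 * (1 / (10 * Real.sqrt (max 2 (16 / am)) * Real.sqrt (27 + 2025 / 8 * am)))) * ((am * ((5 / 4) * Real.sqrt 2) * Real.sqrt (25 / 8) * (8 * Real.sqrt (max 2 (16 / am)) ^ 2)))))) + ((Real.sqrt 216 * (Real.sqrt (8 * Real.exp (3 * min (1 / (10 * Real.sqrt (max 2 (16 / am)) * Real.sqrt (27 + 2025 / 8 * am))) (1 / 4)) * Real.exp (6 * (1 / (10 * Real.sqrt (max 2 (16 / am)) * Real.sqrt (27 + 2025 / 8 * am)))) * (2 * (1 + 1 / (1 / (10 * Real.sqrt (max 2 (16 / am)) * Real.sqrt (27 + 2025 / 8 * am))))) ^ 3) * (8 * Real.sqrt (max 2 (16 / am)) ^ 2))))) * (2 * (1 + 1 / (min (1 / (10 * Real.sqrt (max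 2 (16 / am)) * Real.sqrt (27 + 2025 / 8 * am))) (1 / 4) / 2))) ^ 3) * (1 + (10 * (18 / (2 / ((1 + 25 / 8) * (600 * (27 / 4 : ℝ) ^ 6 + am))) ^ 2) * (4 * (2 * (1 + 1 / (min ((1 / (10 * Real.sqrt (max 2 (16 / am)) * Real.sqrt (27 + 2025 / 8 * am))) / 2) ((2 / ((1 + 25 / 8) * (600 * (27 / 4 : ℝ) ^ 6 + am))) / (3 * (Real.sqrt (max 2 (16 / am)) * (2 + Real.sqrt (max 2 (16 / am))) * (3 * Real.sqrt 3 + 27 + 9 * Real.sqrt am * Real.sqrt (25 / 8) + 81 * am * (25 / 8)) * (8 * Real.sqrt (max 2 (16 / am)) + 8 * Real.sqrt (max 2 (16 / am)) ^ 2) * (10 * Real.sqrt (25 / 8)) + 9 * (max 2 (16 / am)) * Real.sqrt (25 / 8))))))) ^ 3) * (((14 * (8 * Real.exp (3 * min (1 / (10 * Real.sqrt (max 2 (16 / am)) * Real.sqrt (27 + 2025 / 8 * am))) (1 / 4)) * (((5 / 2 : ℝ)) + Real.exp (3 * (1 / (10 * Real.sqrt (max 2 (16 / am)) * Real.sqrt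 (27 + 2025 / 8 * am)))) * ((am * (5 / 2) * (25 / 8) * (8 * max 2 (16 / am))))))) + ((Real.sqrt 432 * (Real.sqrt (8 * Real.exp (3 * min (1 / (10 * Real.sqrt (max 2 (16 / am)) * Real.sqrt (27 + 2025 / 8 * am))) (1 / 4)) * Real.exp (6 * (1 / (10 * Real.sqrt (max 2 (16 / am)) * Real.sqrt (27 + 2025 / 8 * am)))) * (2 * (1 + 1 / (1 / (10 * Real.sqrt (max 2 (16 / am)) * Real.sqrt (27 + 2025 / 8 * am))))) ^ 3) * ((8 * max 2 (16 / am)) * Real.sqrt (25 / 8)))))) * (2 * (1 + 1 / (min (1 / (10 * Real.sqrt (max 2 (16 / am)) * Real.sqrt (27 + 2025 / 8 * am))) (1 / 4) / 2))) ^ 3)) * (((14 * (8 * Real.exp (3 * min (1 / (10 * Real.sqrt (max 2 (16 / am)) * Real.sqrt (27 + 2025 / 8 * am))) (1 / 4)) * (1 + Real.exp (3 * (1 / (10 * Real.sqrt (max 2 (16 / am)) * Real.sqrt (27 + 2025 / 8 * am)))) * ((am * ((5 / 4) * Real.sqrt 2) * Real.sqrt (25 / 8) * (8 * Real.sqrt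 (max 2 (16 / am)) ^ 2)))))) + ((Real.sqrt 216 * (Real.sqrt (8 * Real.exp (3 * min (1 / (10 * Real.sqrt (max 2 (16 / am)) * Real.sqrt (27 + 2025 / 8 * am))) (1 / 4)) * Real.exp (6 * (1 / (10 * Real.sqrt (max 2 (16 / am)) * Real.sqrt (27 + 2025 / 8 * am)))) * (2 * (1 + 1 / (1 / (10 * Real.sqrt (max 2 (16 / am)) * Real.sqrt (27 + 2025 / 8 * am))))) ^ 3) * (8 * Real.sqrt (max 2 (16 / am)) ^ 2))))) * (2 * (1 + 1 / (min (1 / (10 * Real.sqrt (max 2 (16 / am)) * Real.sqrt (27 + 2025 / 8 * am))) (1 / 4) / 2))) ^ 3))) * m := by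
  have hc₀ : 0 < c₀ := Fact.out
  have hL : (0 : ℝ) < F.L := by have := F.hL.2; exact_mod_cast (by omega : 0 < F.L)
  have hε7 : 10 ^ 7 * (F.L : ℝ) ^ 3 * ε₀ ≤ 1 := by
    have h1 : (10 : ℝ) ^ 7 * (F.L : ℝ) ^ 3 * ε₀ ≤ 10 ^ 12 * (F.L : ℝ) ^ 3 * ε₀ := by
      have : 0 ≤ (F.L : ℝ) ^ 3 * ε₀ := by positivity
      nlinarith
    exact h1.trans hε12
  -- the `Q″` of record, its ∃-form top-mean clause and `ker Q″ ≤ N_S`; the Lift identity `R_S = projR Δ Q″`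
  obtain ⟨Q'', D', -, -, htop, hseq, hker⟩ := exists_intertwiner_of_regPr F h (c₀ := c₀) cB hε₀ hε12 U₀ hreg
  have hRS := RS_eq_projR_of_lift F h cB hε₀ hε12 U₀ hreg hLift Q'' htop hker
  -- the LOD data at the pinned weight: `ι` by `rfl`, `T := (ι∘Q″)†`, `G ← exists_massive_inverse`
  haveI : Fact (0 < c₀ * ((F.L : ℝ) ^ 3) ^ (K - n)) := ⟨by positivity⟩
  obtain ⟨ι', hι'⟩ : ∃ ι' : (Site (F.P K) (K - n) → Matrix (Fin 2) (Fin 2) ℂ) →ₗ[ℂ] SiteL2K ℂ 3 (periodsT3 F n) (c₀ * ((F.L : ℝ) ^ 3) ^ (K - n)) W₂,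
      ∀ c, ι' c = toL2S F n (c₀ * ((F.L : ℝ) ^ 3) ^ (K - n)) (fun z => c (siteShift (sites_eq F n K h) z)) :=
    ⟨(toL2S F n (c₀ * ((F.L : ℝ) ^ 3) ^ (K - n))).toLinearMap ∘ₗ LinearMap.funLeft ℂ (Matrix (Fin 2) (Fin 2) ℂ) (siteShift (sites_eq F n K h)), fun c => rfl⟩
  obtain ⟨T', hT'⟩ : ∃ T' : SiteL2K ℂ 3 (periodsT3 F n) (c₀ * ((F.L : ℝ) ^ 3) ^ (K - n)) W₂ →ₗ[ℂ] SiteL2K ℂ 3 (periodsT3 F K) c₀ W₂,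
      ∀ (l : SiteL2K ℂ 3 (periodsT3 F K) c₀ W₂) (f : SiteL2K ℂ 3 (periodsT3 F n) (c₀ * ((F.L : ℝ) ^ 3) ^ (K - n)) W₂), ⟪ι' (Q'' l), f⟫_ℂ = ⟪l, T' f⟫_ℂ :=
    ⟨LinearMap.adjoint (ι' ∘ₗ Q''), fun l f => by rw [LinearMap.adjoint_inner_right, LinearMap.comp_apply]⟩
  obtain ⟨G', hAG', hGA', -⟩ := exists_massive_inverse F h hε₀ hε7 U₀ hreg Q'' hseq ι' hι' T' hT' ham
  exact norm_symm_RS_GprimeP_toL2S_le_member F h hε₀ hε7 U₀ hreg Q'' hseq hRS hker hnK ham ι' hι' T' hT' G' hAG' hGA' ha' v hv x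

end Member

end Summit.QuantumFields.YangMills.Theorems.Prop7GaugeProjectorSupPackageMember

end
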